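import Literature.AlgebraicGeometry.Motives.HodgeThetaSubalgebraSymplecticBlocksRankSix
import Literature.AlgebraicGeometry.Motives.SymplecticRankFourIdeals
import HarnessLib

/-!
# Rational Lie algebras containing the Hodge operator on a weight-one Hodge structure with SIX-dimensional real eigenblocks
# are all of `𝔰𝔭_E(V, ψ)`: `𝔤_ℂ = ⊕_i 𝔰𝔭(T_i) ≅ 𝔰𝔭₆^{#blocks}`, `𝔤 = Lie Hg`, and Theorem L (Ribet 1983 Thm. 1 in relative
# dimension THREE: `End⁰A = F` totally real, `dim A = 3[F:ℚ]` ⟹ `Hg(A) = R_{F/ℚ} Sp_{6,F}`)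

Family `hodge`, layer `Literature/AlgebraicGeometry/Motives` (abstract polarizable `ℚ`-Hodge structures; no geometry).
THEOREMS ONLY (no definition, no named fact; D-0026); UNCONDITIONAL; no step towards a summit statement. Written for the
cell `pub-hodge-ring2` (HONEST FRAMING: research route conditional on HC_CM; not a corollary; Q11.4-sentence-2 already
refuted in dim ≥ 3), Literature lane gen 82, programme R59 «Ribet 1983 in relative dimension three», file A2 = the GOURSAT
ASSEMBLY over the real places. It is the rank-six twin of the tree's `HodgeThetaSubalgebraSymplecticBlocks` §3–§5 (rank four,
Moonen–Zarhin 1995 Type I(2)), with the per-block Lie step `SpBlocksThetaSix.exists_mem_spanC_restrict_eq` of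
`HodgeThetaSubalgebraSymplecticBlocksRankSix` (where the E³-type skeleton of Moonen–Zarhin 1999 (2.5) is excluded
arithmetically) in place of the rank-four core theorem, and «`𝔰𝔭₆` is simple and centre-free» (§0 here) in place of
`SymplecticRankFourIdeals`.

THE PRINTED THEOREM. K. A. Ribet, *Hodge classes on certain types of abelian varieties*, Amer. J. Math. 105 (1983), Thm. 1
(Gordon's survey Thm. 6.3 [held `paper:arxiv-alg-geom_9709030` p. 18]): «suppose `End⁰A` is a totally real field of degree
`e` over `ℚ`, and `d/e` is odd … Then `Hg(A) = Lf(A)` and thus `Hdg(Aⁿ) = Div(Aⁿ)` for `n ≥ 1`», where for totally real `F`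
«`Hg(A) = Lf(A) = Res_{F/ℚ} Sp(W_0, ψ)`, `Hg(A, ℂ) ≃ ∏_σ Sp(U_σ, ψ_σ)`» (Gordon p. 18). This file is the case `d/e = 3` in
Lie-algebra form and for EVERY admissible rational algebra (Deligne's minimality principle, LNM 900 I Prop. 3.4): the Hodge
Lie algebra is characterised as the unique bracket-closed `ℚ`-subspace of `𝔰𝔭_E(V, ψ)` whose complexification contains `Θ`.

SETTING (as in `HodgeThetaSubalgebraSymplecticBlocks`). `H` an effective polarized `ℚ`-Hodge structure of weight `1` on a
finite-dimensional `V`; `ψ` a polarization for which every Hodge endomorphism is `ψ`-self-adjoint (`hself`); `σ_i : E → ℂ`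
REAL characters of `E = End_Hdg(V)` whose eigenblocks `T_i = H.eigenBlock (σ i)` form an internal direct sum `V_ℂ = ⊕_i T_i`
and are SIX-dimensional (`h6`); `Θ` a Hodge operator; `𝔤` ADMISSIBLE: a bracket-closed `ℚ`-subspace of `End_ℚ(V)` of
`ψ`-skew operators commuting with `E` with `Θ ∈ 𝔤_ℂ = spanC 𝔤` (`hbr`, `hcomm`, `hskew`, `hΘ𝔤`).

* §0 «`𝔰𝔭₆` IS SIMPLE AND CENTRE-FREE» in the Siegel block form (an abstract `M` with nondegenerate alternating `ω`, a skew
  involution `T` with three-dimensional `+1`-eigenspace `P`): `SymplecticIdealSix.mem_of_ne_bot` — a non-zero ideal of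
  `𝔰𝔭(M, ω)` is everything (it contains `T` by `SymplecticIdeal.theta_mem_of_ne_bot`, acts irreducibly, and in the rank-six
  dichotomy `SymplecticThetaSix.core_dichotomy` the E³-skeleton is impossible because the root operators `ω(p,·) ⊗ p`,
  `p ∈ P`, give two non-proportional elements of `I ∩ 𝔲⁺`); `SymplecticIdealSix.eq_zero_of_forall_bracket_eq_zero` — a skew
  operator commuting with `𝔰𝔭(M, ω)` is `0`.
* §1 `SymplecticBlocksSix.exists_blockData` — on a six-dimensional real eigenblock: `ω_i = ψ_ℂ|_{T_i}` non-degenerate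
  alternating, `Θ|_{T_i}` a skew involution with three-dimensional eigenspaces.
* §2 `SpBlocksThetaSix.restrict_ideal_dichotomy` (an ideal of `𝔤_ℂ` kills `T_j` or restricts onto `𝔰𝔭(T_j)`),
  `SpBlocksThetaSix.apply_eq_zero_of_forall_commute`, `SpBlocksThetaSix.isSemisimple` (`𝔤_ℂ` is semisimple).
* §3 the Goursat step: `SpBlocksThetaSix.exists_complement_ideal`, `SpBlocksThetaSix.eq_zero_of_equivariant` (no
  intertwiners between distinct blocks), `SpBlocksThetaSix.exists_mem_spanC_supported` (supported lifts: `Y ∈ 𝔤_ℂ` with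
  `Y|_{T_i} = g`, `Y|_{T_j} = 0` for `j ≠ i`).
* §4 **`SpBlocksThetaSix.mem_spanC_iff_mapsTo_and_skew`** (`𝔤_ℂ = 𝔰𝔭_E(V, ψ)_ℂ = ⊕_i 𝔰𝔭(T_i)`),
  **`SpBlocksThetaSix.mem_iff_commute_and_skew`** (`𝔤 = 𝔰𝔭_E(V, ψ)`), **`SpBlocksThetaSix.eq_hodgeLie`** (`𝔤 = Lie Hg(H)`),
  `SpBlocksThetaSix.mem_hodgeLieC_iff_mapsTo_and_skew`, `SpBlocksThetaSix.mem_hodgeLie_iff_commute_and_skew`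
  (`Lie Hg(H) = 𝔰𝔭_E(V, ψ)`: Ribet's `Hg(A) = Res_{F/ℚ} Sp(W_0, ψ)` in Lie form), and THEOREM L in the word model
  `SpBlocksThetaSix.wordDerAt_eq_zero_of_mapsTo_of_skew` (a rational tensor killed by `Θ` is killed by every block-preserving
  `ψ_ℂ`-skew operator — the Lie step of «`B•(Aⁿ) = D•(Aⁿ)`»).

The proofs of §2–§4 are those of `HodgeThetaSubalgebraSymplecticBlocks` §3–§5 line by line, with `4 ↦ 6`.

## References

* [Ribet1983] K. A. Ribet, *Hodge classes on certain types of abelian varieties*, Amer. J. Math. 105 (1983) 523–538, Thm. 1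
  (and Thm. 0). [cite: Ribet1983, Thm. 1]
* [Gordon1997] B. B. Gordon, *A survey of the Hodge conjecture for abelian varieties* (arXiv:alg-geom/9709030), Thm. 6.3 and
  the sketch of proof of Thm. 6.2, p. 18. [cite: Gordon1997, Thm. 6.3 (arXiv:alg-geom/9709030 p. 18)]
* [MoonenZarhin1999LowDim] B. Moonen, Yu. G. Zarhin, Math. Ann. 315 (1999) 711–733, §2 (2.3), (2.5), §3 (3.1) and Lemma (3.4).
  [cite: MoonenZarhin1999LowDim, §3 (3.1) and Lemma (3.4)]
* [Deligne1982HodgeCycles] P. Deligne, LNM 900 (1982), I §3 Prop. 3.4. [cite: Deligne1982HodgeCycles, I §3 Prop. 3.4]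
* [Hazama1983] F. Hazama, Tôhoku Math. J. 35 (1983), §3 pp. 305–306. [cite: Hazama1983, §3 (pp. 305–306)]
* [Humphreys1972] J. E. Humphreys, GTM 9 (1972), §1.2, §5.2, §19.1. [cite: Humphreys1972, §5.2]
* [GoodmanWallachGTM255] R. Goodman, N. R. Wallach, GTM 255 (2009), §2.1.2, §2.5.3. [cite: GoodmanWallachGTM255, §2.1.2 and §2.5.3]
-/

noncomputable section

open scoped TensorProduct

namespace Literature.AlgebraicGeometry.Motives

namespace HodgeStructure

universe u

/-! ### §0 `𝔰𝔭₆` is simple and centre-free (Siegel block form, `dim P = 3`) -/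

section RankSix

variable {M : Type*} [AddCommGroup M] [Module ℂ M]

/-- **«`𝔰𝔭₆` is simple»: a non-zero ideal of `𝔰𝔭(M, ω)` (`T` a skew involution with three-dimensional `+1`-eigenspace `P`)
contains every `ω`-skew operator.** It contains `T` (`SymplecticIdeal.theta_mem_of_ne_bot`), hence acts irreducibly on `M`
(`SymplecticIdeal.eq_bot_or_top_of_stable_of_theta_mem`); in the rank-six dichotomy `SymplecticThetaSix.core_dichotomy` the
full branch gives everything (`SpBlocksThetaSix.mem_of_skew_of_levi`) and the E³-skeleton branch is absurd: the root operators
`R_p = ω(p, ·) ⊗ p` (`p ∈ P`) lie in `I ∩ 𝔲⁺` (as `−½[R_p, T]`) and would all be proportional to `B₀`, whereas `R_{p₁}`,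
`R_{p₂}` have images `ℂp₁`, `ℂp₂`. [cite: GoodmanWallachGTM255, §2.1.2 and §2.5.3] [cite: Humphreys1972, §1.2 and §19.1]
[cite: MoonenZarhin1999LowDim, §2 (2.3), (2.5)] -/
theorem SymplecticIdealSix.mem_of_ne_bot [FiniteDimensional ℂ M] (ω : LinearMap.BilinForm ℂ M) (hωnd : ω.Nondegenerate)
    (hωalt : ∀ x y, ω x y = -ω y x) {T : Module.End ℂ M} (hTT : ∀ v, T (T v) = v)
    (hTskew : ∀ x y, ω (T x) y + ω x (T y) = 0) {P Q : Submodule ℂ M} (hP : ∀ x ∈ P, T x = x)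
    (hQ : ∀ x ∈ Q, T x = -x) (hPmem : ∀ v, (2 : ℂ)⁻¹ • (v + T v) ∈ P) (hQmem : ∀ v, (2 : ℂ)⁻¹ • (v - T v) ∈ Q)
    (hP3 : Module.finrank ℂ P = 3) (I : Submodule ℂ (Module.End ℂ M))
    (hIskew : ∀ Y ∈ I, ∀ x y, ω (Y x) y + ω x (Y y) = 0)
    (hI : ∀ Z : Module.End ℂ M, (∀ x y, ω (Z x) y + ω x (Z y) = 0) → ∀ Y ∈ I, Z * Y - Y * Z ∈ I) (hI0 : I ≠ ⊥)
    {Y : Module.End ℂ M} (hYskew : ∀ x y, ω (Y x) y + ω x (Y y) = 0) : Y ∈ I := by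
  classical
  have hTI : T ∈ I := SymplecticIdeal.theta_mem_of_ne_bot ω hωnd hωalt hTT hTskew hP hQ hPmem hQmem I hIskew hI hI0
  have hP0 : P ≠ ⊥ := by
    intro h
    rw [h, finrank_bot] at hP3
    exact absurd hP3 (by norm_num)
  have hIbr : ∀ Z ∈ I, ∀ Z' ∈ I, Z * Z' - Z' * Z ∈ I := fun Z hZ Z' hZ' => hI Z (hIskew Z hZ) Z' hZ'
  have hirr : ∀ U : Submodule ℂ M, (∀ Z ∈ I, ∀ u ∈ U, Z u ∈ U) → U = ⊥ ∨ U = ⊤ :=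
    SymplecticIdeal.eq_bot_or_top_of_stable_of_theta_mem ω hωnd hωalt hTskew hP hQ hPmem hQmem hP0 I hI hTI
  rcases SymplecticThetaSix.core_dichotomy ω hωnd hωalt I hIbr hIskew hTI hTT hP hQ hPmem hQmem hirr hP3 with
    ⟨hA, hB, hC⟩ | hbad
  · exact SpBlocksThetaSix.mem_of_skew_of_levi ω I hTT hTskew hP hQ hPmem hQmem hA hB hC hYskew
  exfalso
  obtain ⟨B₀, -, C₁, -, -, -, -, -, -, -, hlineS, -⟩ := hbad
  -- the root operators `R_p = ω(p, ·) ⊗ p`, `p ∈ P`, lie in `I ∩ 𝔲⁺`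
  have hPP := SymplecticIdeal.isotropic_of_skew_involution ω hTskew hP
  have hωTP : ∀ a ∈ P, ∀ v, ω a (T v) = -ω a v := fun a ha v => by
    have h := hTskew a v
    rw [hP a ha] at h
    linear_combination h
  have hRskew : ∀ a : M, ∀ x y, ω ((ω a).smulRight a x) y + ω x ((ω a).smulRight a y) = 0 :=
    fun a => SymplecticIdeal.smulRight_self_skew ω hωalt a
  have hRP : ∀ p ∈ P, (ω p).smulRight p ∈ I := by
    intro p hp
    have hbr : (ω p).smulRight p * T - T * (ω p).smulRight p = (-2 : ℂ) • (ω p).smulRight p := by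
      refine LinearMap.ext fun v => ?_
      simp only [LinearMap.sub_apply, Module.End.mul_apply, LinearMap.smulRight_apply, LinearMap.smul_apply, map_smul,
        hωTP p hp, hP p hp]
      module
    have h := hI _ (hRskew p) T hTI
    rw [hbr] at h
    have h' := I.smul_mem ((-2 : ℂ)⁻¹) h
    rwa [smul_smul, inv_mul_cancel₀ (by norm_num : (-2 : ℂ) ≠ 0), one_smul] at h'
  have hRkill : ∀ p ∈ P, ∀ p' ∈ P, (ω p).smulRight p p' = 0 := fun p hp p' hp' => by
    rw [LinearMap.smulRight_apply, hPP p hp p' hp', zero_smul]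
  have hRim : ∀ p ∈ P, ∀ v, (ω p).smulRight p v ∈ P := fun p hp v => by
    rw [LinearMap.smulRight_apply]
    exact P.smul_mem _ hp
  -- two non-proportional vectors of `P`
  obtain ⟨p₁, hp₁P, hp₁0⟩ := (Submodule.ne_bot_iff P).1 hP0
  have hnot : ¬ (P : Set M) ⊆ (ℂ ∙ p₁ : Submodule ℂ M) := by
    intro hle
    have h1 := Submodule.finrank_mono (show P ≤ ℂ ∙ p₁ from hle)
    rw [finrank_span_singleton hp₁0, hP3] at h1
    omega
  obtain ⟨p₂, hp₂P, hp₂⟩ := Set.not_subset.1 hnot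
  have hp₂0 : p₂ ≠ 0 := fun h => hp₂ (by rw [h]; exact Submodule.zero_mem _)
  obtain ⟨c₁, hc₁⟩ := hlineS _ (hRP p₁ hp₁P) (hRkill p₁ hp₁P) (hRim p₁ hp₁P)
  obtain ⟨c₂, hc₂⟩ := hlineS _ (hRP p₂ hp₂P) (hRkill p₂ hp₂P) (hRim p₂ hp₂P)
  obtain ⟨q₁, hq₁⟩ : ∃ q, ω p₁ q ≠ 0 := by
    by_contra h
    push Not at h
    exact hp₁0 (hωnd.1 p₁ h)
  obtain ⟨q, hq⟩ : ∃ q, ω p₂ q ≠ 0 := by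
    by_contra h
    push Not at h
    exact hp₂0 (hωnd.1 p₂ h)
  have hc₁0 : c₁ ≠ 0 := by
    intro h0
    rw [h0, zero_smul] at hc₁
    have h := congrArg (fun f : Module.End ℂ M => f q₁) hc₁
    simp only [LinearMap.smulRight_apply, LinearMap.zero_apply, smul_eq_zero] at h
    exact h.elim hq₁ hp₁0
  have hB₀ : B₀ = c₁⁻¹ • (ω p₁).smulRight p₁ := by rw [hc₁, smul_smul, inv_mul_cancel₀ hc₁0, one_smul]
  have h' : (ω p₂ q) • p₂ = (c₂ * c₁⁻¹ * ω p₁ q) • p₁ := by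
    have h := congrArg (fun f : Module.End ℂ M => f q) hc₂
    simp only [LinearMap.smulRight_apply, LinearMap.smul_apply] at h
    rw [h, hB₀, LinearMap.smul_apply, LinearMap.smulRight_apply, smul_smul, smul_smul]
  apply hp₂
  rw [SetLike.mem_coe, Submodule.mem_span_singleton]
  exact ⟨(ω p₂ q)⁻¹ * (c₂ * c₁⁻¹ * ω p₁ q), by rw [← smul_smul, ← h', smul_smul, inv_mul_cancel₀ hq, one_smul]⟩

/-- **«`𝔰𝔭₆` has trivial centre»**: an `ω`-skew `Z` commuting with every `ω`-skew operator is `0` (`dim P = 3`). Otherwise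
`ℂ Z` is a non-zero ideal, hence contains `T` and the non-zero nilpotent root operator `R_p = ω(p, ·) ⊗ p` (`p ∈ P`): but
`T² = 1` forces `Z` invertible and then `R_p = c Z` invertible or zero — absurd (the proof of the tree's rank-four
`SymplecticIdeal.eq_zero_of_forall_bracket_eq_zero`). [cite: GoodmanWallachGTM255, §2.1.2 and §2.5.3]
[cite: Humphreys1972, §1.2 and §19.1] -/
theorem SymplecticIdealSix.eq_zero_of_forall_bracket_eq_zero [FiniteDimensional ℂ M] (ω : LinearMap.BilinForm ℂ M)
    (hωnd : ω.Nondegenerate) (hωalt : ∀ x y, ω x y = -ω y x) {T : Module.End ℂ M} (hTT : ∀ v, T (T v) = v)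
    (hTskew : ∀ x y, ω (T x) y + ω x (T y) = 0) {P Q : Submodule ℂ M} (hP : ∀ x ∈ P, T x = x)
    (hQ : ∀ x ∈ Q, T x = -x) (hPmem : ∀ v, (2 : ℂ)⁻¹ • (v + T v) ∈ P) (hQmem : ∀ v, (2 : ℂ)⁻¹ • (v - T v) ∈ Q)
    (hP3 : Module.finrank ℂ P = 3) {Z : Module.End ℂ M} (hZskew : ∀ x y, ω (Z x) y + ω x (Z y) = 0)
    (hZ : ∀ W : Module.End ℂ M, (∀ x y, ω (W x) y + ω x (W y) = 0) → W * Z - Z * W = 0) : Z = 0 := by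
  classical
  by_contra hZ0
  set I : Submodule ℂ (Module.End ℂ M) := ℂ ∙ Z with hIdef
  have hIskew : ∀ Y ∈ I, ∀ x y, ω (Y x) y + ω x (Y y) = 0 := by
    intro Y hY x y
    obtain ⟨c, rfl⟩ := Submodule.mem_span_singleton.1 hY
    simp only [LinearMap.smul_apply, map_smul, smul_eq_mul]
    have h := hZskew x y
    linear_combination c * h
  have hI : ∀ W : Module.End ℂ M, (∀ x y, ω (W x) y + ω x (W y) = 0) → ∀ Y ∈ I, W * Y - Y * W ∈ I := by
    intro W hW Y hY
    obtain ⟨c, rfl⟩ := Submodule.mem_span_singleton.1 hY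
    rw [mul_smul_comm, smul_mul_assoc, ← smul_sub, hZ W hW, smul_zero]
    exact I.zero_mem
  have hI0 : I ≠ ⊥ := by
    rw [hIdef, Ne, Submodule.span_singleton_eq_bot]
    exact hZ0
  have hall := fun {Y : Module.End ℂ M} (hY : ∀ x y, ω (Y x) y + ω x (Y y) = 0) =>
    SymplecticIdealSix.mem_of_ne_bot ω hωnd hωalt hTT hTskew hP hQ hPmem hQmem hP3 I hIskew hI hI0 hY
  -- `T = c Z`, so `Z` is invertible up to the scalar `c ≠ 0`
  obtain ⟨c, hc⟩ := Submodule.mem_span_singleton.1 (hall hTskew)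
  -- a non-zero root operator `R_p ∈ I`, `R_p² = 0`
  have hP0 : P ≠ ⊥ := by
    intro h
    rw [h, finrank_bot] at hP3
    exact absurd hP3 (by norm_num)
  obtain ⟨p, hpP, hp0⟩ := (Submodule.ne_bot_iff P).1 hP0
  obtain ⟨c', hc'⟩ := Submodule.mem_span_singleton.1 (hall (SymplecticIdeal.smulRight_self_skew ω hωalt p))
  have hPP := SymplecticIdeal.isotropic_of_skew_involution ω hTskew hP
  have hR2 : (ω p).smulRight p * (ω p).smulRight p = 0 := by
    refine LinearMap.ext fun v => ?_
    simp only [Module.End.mul_apply, LinearMap.smulRight_apply, map_smul, hPP p hpP p hpP, zero_smul, smul_zero,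
      LinearMap.zero_apply]
  have hR0 : (ω p).smulRight p ≠ 0 := by
    intro h0
    have hq : ∃ q ∈ Q, ω p q ≠ 0 := by
      by_contra h
      push Not at h
      exact hp0 (SymplecticIdeal.eq_zero_of_forall_Q ω hωnd hTskew hP hPmem hQmem hpP h)
    obtain ⟨q, -, hq⟩ := hq
    have h1 := congrArg (fun f : Module.End ℂ M => f q) h0
    simp only [LinearMap.smulRight_apply, LinearMap.zero_apply, smul_eq_zero] at h1
    exact h1.elim hq hp0
  -- `T² = 1` and `R_p² = 0` are incompatible with both lying on the line `ℂ Z`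
  have hT2 : T * T = 1 := LinearMap.ext fun v => by rw [Module.End.mul_apply, hTT, Module.End.one_apply]
  have hc0 : c ≠ 0 := by
    intro h
    rw [h, zero_smul] at hc
    have h1 := congrArg (fun f : Module.End ℂ M => f p) hc
    simp only [LinearMap.zero_apply] at h1
    rw [hP p hpP] at h1
    exact hp0 h1.symm
  have hZT : Z = c⁻¹ • T := by rw [← hc, smul_smul, inv_mul_cancel₀ hc0, one_smul]
  have hRT : (ω p).smulRight p = (c' * c⁻¹) • T := by rw [← hc', hZT, smul_smul]
  have h1 : ((c' * c⁻¹) * (c' * c⁻¹)) • (1 : Module.End ℂ M) = 0 := by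
    rw [← hT2, ← smul_smul, ← smul_mul_assoc, ← mul_smul_comm, ← hRT, hR2]
  have h2 : (c' * c⁻¹) * (c' * c⁻¹) = 0 := by
    have h := congrArg (fun f : Module.End ℂ M => f p) h1
    simp only [LinearMap.smul_apply, Module.End.one_apply, LinearMap.zero_apply, smul_eq_zero] at h
    exact h.resolve_right hp0
  have h3 : c' * c⁻¹ = 0 := mul_self_eq_zero.1 h2
  rw [h3, zero_smul] at hRT
  exact hR0 hRT

end RankSix

variable {V : Type u} [AddCommGroup V] [Module ℚ V] [Module.Finite ℚ V] [HodgeTensorFacts.{u, u}] {n : ℤ}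
variable {ι : Type*} [DecidableEq ι]

/-! ### §1 Block data on a six-dimensional real eigenblock -/

/-- **Block data on a six-dimensional real eigenblock `T_i`**: the restricted form `ω_i = ψ_ℂ|_{T_i}` is non-degenerate
(`SymplecticBlocks.eq_zero_of_forall_block`) and alternating (weight one); `Θ|_{T_i}` is an `ω_i`-skew involution whose
eigenspaces `P_i = T_i ∩ V^{1,0}`, `Q_i = T_i ∩ V^{0,1}` are THREE-dimensional (`T_i` is real: `conj` exchanges the graded
pieces, `SpBlocksThetaSix.finrank_inf_piece_eq_half`). The tree's `SymplecticBlocks.exists_blockData` with `4 ↦ 6`.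
[cite: Zarhin1983HodgeGroupsK3, §2] [cite: Hazama1983, §3 (pp. 305–306)] [cite: MoonenZarhin1999LowDim, §2 (2.3)] -/
theorem SymplecticBlocksSix.exists_blockData (H : HodgeStructure V n) (hn : n = 1) (heff : H.IsEffective)
    (ψ : H.Polarization)
    (hself : ∀ a : H.endAlg, LinearMap.IsAdjointPair ψ.form ψ.form (a : Module.End ℚ V) (a : Module.End ℚ V))
    (σ : ι → (H.endAlg →+* ℂ)) (hreal : ∀ i, (starRingEnd ℂ).comp (σ i) = σ i)
    (hint : DirectSum.IsInternal fun i => H.eigenBlock (σ i)) (h6 : ∀ i, Module.finrank ℂ (H.eigenBlock (σ i)) = 6)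
    {Θ : Module.End ℂ (ℂ ⊗[ℚ] V)} (hΘ : ∀ p, ∀ x ∈ H.piece p (n - p), Θ x = ((2 * p - n : ℤ) : ℂ) • x) (i : ι) :
    ((ψ.form.baseChange ℂ).compl₁₂ (H.eigenBlock (σ i)).subtype (H.eigenBlock (σ i)).subtype).Nondegenerate ∧
    (∀ x y : H.eigenBlock (σ i), (ψ.form.baseChange ℂ).compl₁₂ (H.eigenBlock (σ i)).subtype (H.eigenBlock (σ i)).subtype x y =
      -(ψ.form.baseChange ℂ).compl₁₂ (H.eigenBlock (σ i)).subtype (H.eigenBlock (σ i)).subtype y x) ∧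
    ∃ (TΘ : Module.End ℂ ↥(H.eigenBlock (σ i))) (P Q : Submodule ℂ ↥(H.eigenBlock (σ i))),
      (∀ x : H.eigenBlock (σ i), ((TΘ x : H.eigenBlock (σ i)) : ℂ ⊗[ℚ] V) = Θ x) ∧ (∀ v, TΘ (TΘ v) = v) ∧
      (∀ x y : H.eigenBlock (σ i), (ψ.form.baseChange ℂ).compl₁₂ (H.eigenBlock (σ i)).subtype (H.eigenBlock (σ i)).subtype (TΘ x) y +
        (ψ.form.baseChange ℂ).compl₁₂ (H.eigenBlock (σ i)).subtype (H.eigenBlock (σ i)).subtype x (TΘ y) = 0) ∧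
      (∀ x ∈ P, TΘ x = x) ∧ (∀ x ∈ Q, TΘ x = -x) ∧ (∀ v, (2 : ℂ)⁻¹ • (v + TΘ v) ∈ P) ∧ (∀ v, (2 : ℂ)⁻¹ • (v - TΘ v) ∈ Q) ∧
      Module.finrank ℂ P = 3 ∧ Module.finrank ℂ Q = 3 := by
  subst hn
  set T := H.eigenBlock (σ i) with hT
  have h6' : Module.finrank ℂ T = 2 * 3 := (h6 i).trans (by norm_num)
  have hΘC : Θ ∈ H.hodgeLieC := H.mem_hodgeLieC_of_forall_piece hΘ
  obtain ⟨hPv, hQv, hΘ10, hΘ01, hΘΘ⟩ := UnitaryTheta.theta_facts H rfl heff hΘ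
  have hYT : ∀ Y ∈ H.hodgeLieC, ∀ x ∈ T, Y x ∈ T := fun Y hY x hx => H.apply_mem_eigenBlock_of_mem_hodgeLieC hY hx
  set ω : LinearMap.BilinForm ℂ ↥T := (ψ.form.baseChange ℂ).compl₁₂ T.subtype T.subtype with hω
  have hω_apply : ∀ x y : T, ω x y = ψ.form.baseChange ℂ (x : ℂ ⊗[ℚ] V) y := fun x y => rfl
  have hsepL : ∀ x : T, (∀ y : T, ω x y = 0) → x = 0 := by
    intro x hx
    exact Subtype.ext (SymplecticBlocks.eq_zero_of_forall_block H ψ hself σ hint i x.2 fun y hy => by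
      have h := hx ⟨y, hy⟩
      rwa [hω_apply] at h)
  have hωalt : ∀ x y : T, ω x y = -ω y x := fun x y => by
    rw [hω_apply, hω_apply, form_baseChange_swap_of_odd H odd_one ψ]
  refine ⟨⟨fun x hx => hsepL x hx, fun y hy => hsepL y fun x => by rw [hωalt, hy x, neg_zero]⟩, hωalt, ?_⟩
  set TΘ : Module.End ℂ ↥T := Θ.restrict fun x hx => hYT Θ hΘC x hx with hTΘ
  have hTΘ_coe : ∀ x : T, ((TΘ x : T) : ℂ ⊗[ℚ] V) = Θ x := fun x => rfl
  have hTconj : ∀ x ∈ T, conj x ∈ T := fun x hx => SymplecticBlocks.conj_mem_eigenBlock_of_real H (hreal i) hx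
  obtain ⟨hP3', hQ3'⟩ := SpBlocksThetaSix.finrank_inf_piece_eq_half H rfl heff hΘ hTconj (hYT Θ hΘC) h6'
  refine ⟨TΘ, (H.piece 1 0).comap T.subtype, (H.piece 0 1).comap T.subtype, hTΘ_coe,
    fun v => Subtype.ext (by rw [hTΘ_coe, hTΘ_coe, hΘΘ]), fun x y => ?_,
    fun x hx => Subtype.ext (by rw [hTΘ_coe]; exact hΘ10 _ hx),
    fun x hx => Subtype.ext (by rw [hTΘ_coe, Submodule.coe_neg]; exact hΘ01 _ hx), fun v => ?_, fun v => ?_, ?_, ?_⟩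
  · rw [hω_apply, hω_apply, hTΘ_coe, hTΘ_coe, formBaseChange_skew_of_mem_hodgeLieC ψ hΘC, neg_add_cancel]
  · change (((2 : ℂ)⁻¹ • (v + TΘ v) : T) : ℂ ⊗[ℚ] V) ∈ H.piece 1 0
    rw [Submodule.coe_smul, Submodule.coe_add, hTΘ_coe]
    exact hPv _
  · change (((2 : ℂ)⁻¹ • (v - TΘ v) : T) : ℂ ⊗[ℚ] V) ∈ H.piece 0 1
    rw [Submodule.coe_smul, Submodule.coe_sub, hTΘ_coe]
    exact hQv _
  · have hPeq : (H.piece 1 0).comap T.subtype = (T ⊓ H.piece 1 0).comap T.subtype := by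
      ext x
      simp only [Submodule.mem_comap, Submodule.coe_subtype, Submodule.mem_inf, SetLike.coe_mem, true_and]
    rw [hPeq, (Submodule.comapSubtypeEquivOfLe (inf_le_left : T ⊓ H.piece 1 0 ≤ T)).finrank_eq, hP3']
  · have hQeq : (H.piece 0 1).comap T.subtype = (T ⊓ H.piece 0 1).comap T.subtype := by
      ext x
      simp only [Submodule.mem_comap, Submodule.coe_subtype, Submodule.mem_inf, SetLike.coe_mem, true_and]
    rw [hQeq, (Submodule.comapSubtypeEquivOfLe (inf_le_left : T ⊓ H.piece 0 1 ≤ T)).finrank_eq, hQ3']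


/-! ### §2 Ideals of `𝔤_ℂ` on a block; `𝔤_ℂ` is semisimple -/

/-- **An ideal of `𝔤_ℂ` either kills the block `T_j` or restricts ONTO `𝔰𝔭(T_j)`** (its restrictions form an ideal of
`𝔰𝔭(T_j) = c_j(𝔤_ℂ)` by `SpBlocksThetaSix.exists_mem_spanC_restrict_eq`, and «`𝔰𝔭₆` is simple»,
`SymplecticIdealSix.mem_of_ne_bot`); the tree's `SpBlocksTheta.restrict_ideal_dichotomy` with `4 ↦ 6`. [cite: MoonenZarhin1999LowDim, §3 (3.1) and Lemma (3.4)]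
[cite: Humphreys1972, §5.2] -/
theorem SpBlocksThetaSix.restrict_ideal_dichotomy (H : HodgeStructure V n) (hn : n = 1) (heff : H.IsEffective)
    (ψ : H.Polarization)
    (hself : ∀ a : H.endAlg, LinearMap.IsAdjointPair ψ.form ψ.form (a : Module.End ℚ V) (a : Module.End ℚ V))
    (σ : ι → (H.endAlg →+* ℂ)) (hreal : ∀ i, (starRingEnd ℂ).comp (σ i) = σ i)
    (hint : DirectSum.IsInternal fun i => H.eigenBlock (σ i)) (h6 : ∀ i, Module.finrank ℂ (H.eigenBlock (σ i)) = 6)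
    (𝔤 : Submodule ℚ (Module.End ℚ V)) (hbr : ∀ X ∈ 𝔤, ∀ X' ∈ 𝔤, X * X' - X' * X ∈ 𝔤) {Θ : Module.End ℂ (ℂ ⊗[ℚ] V)}
    (hΘ : ∀ p, ∀ x ∈ H.piece p (n - p), Θ x = ((2 * p - n : ℤ) : ℂ) • x) (hΘ𝔤 : Θ ∈ spanC 𝔤)
    (hcomm : ∀ X ∈ 𝔤, ∀ a : H.endAlg, X * (a : Module.End ℚ V) = (a : Module.End ℚ V) * X)
    (hskew : ∀ X ∈ 𝔤, ∀ v w, ψ.form (X v) w + ψ.form v (X w) = 0)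
    (N : Submodule ℂ (Module.End ℂ (ℂ ⊗[ℚ] V))) (hN : N ≤ spanC 𝔤)
    (hNideal : ∀ W ∈ spanC 𝔤, ∀ Y ∈ N, W * Y - Y * W ∈ N) (j : ι) :
    (∀ Y ∈ N, ∀ x ∈ H.eigenBlock (σ j), Y x = 0) ∨
      ∀ g : Module.End ℂ ↥(H.eigenBlock (σ j)),
        (∀ x y : H.eigenBlock (σ j), ψ.form.baseChange ℂ ((g x : H.eigenBlock (σ j)) : ℂ ⊗[ℚ] V) y +
          ψ.form.baseChange ℂ (x : ℂ ⊗[ℚ] V) ((g y : H.eigenBlock (σ j)) : ℂ ⊗[ℚ] V) = 0) →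
        ∃ Y ∈ N, ∀ x : H.eigenBlock (σ j), ((g x : H.eigenBlock (σ j)) : ℂ ⊗[ℚ] V) = Y x := by
  classical
  obtain ⟨hωnd, hωalt, TΘ, P, Q, hTΘ, hTT, hTskew, hP, hQ, hPmem, hQmem, hP3, hQ3⟩ :=
    SymplecticBlocksSix.exists_blockData H hn heff ψ hself σ hreal hint h6 hΘ j
  set T := H.eigenBlock (σ j) with hT
  set ω : LinearMap.BilinForm ℂ ↥T := (ψ.form.baseChange ℂ).compl₁₂ T.subtype T.subtype with hω
  have hω_apply : ∀ x y : T, ω x y = ψ.form.baseChange ℂ (x : ℂ ⊗[ℚ] V) y := fun x y => rfl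
  have hYT : ∀ Y ∈ spanC 𝔤, ∀ x ∈ T, Y x ∈ T := fun Y hY x hx => SpBlocksTheta.apply_mem_eigenBlock H σ hcomm hY j hx
  have hYskew : ∀ Y ∈ spanC 𝔤, ∀ x y, ψ.form.baseChange ℂ (Y x) y + ψ.form.baseChange ℂ x (Y y) = 0 :=
    fun Y hY => ThetaSubalgebra.formBaseChange_add_eq_zero_of_mem_spanC ψ hskew hY
  -- the restrictions of `N`
  let I : Submodule ℂ (Module.End ℂ ↥T) :=
    { carrier := {g | ∃ Y ∈ N, ∀ x : T, ((g x : T) : ℂ ⊗[ℚ] V) = Y x}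
      zero_mem' := ⟨0, N.zero_mem, fun x => by simp⟩
      add_mem' := by
        rintro g₁ g₂ ⟨Y₁, hY₁, h₁⟩ ⟨Y₂, hY₂, h₂⟩
        exact ⟨Y₁ + Y₂, N.add_mem hY₁ hY₂, fun x => by rw [LinearMap.add_apply, Submodule.coe_add, h₁, h₂, LinearMap.add_apply]⟩
      smul_mem' := by
        rintro c g ⟨Y, hY, h⟩
        exact ⟨c • Y, N.smul_mem c hY, fun x => by rw [LinearMap.smul_apply, Submodule.coe_smul, h, LinearMap.smul_apply]⟩ }
  have hmemI : ∀ g, g ∈ I ↔ ∃ Y ∈ N, ∀ x : T, ((g x : T) : ℂ ⊗[ℚ] V) = Y x := fun g => Iff.rfl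
  have hIskew : ∀ g ∈ I, ∀ x y : T, ω (g x) y + ω x (g y) = 0 := by
    rintro g ⟨Y, hY, h⟩ x y
    rw [hω_apply, hω_apply, h, h]
    exact hYskew Y (hN hY) _ _
  -- `I` is an ideal of `𝔰𝔭(T)`: every skew `Z` on `T` is a restriction of some `W ∈ 𝔤_ℂ` (§2)
  have hI : ∀ Z : Module.End ℂ ↥T, (∀ x y : T, ω (Z x) y + ω x (Z y) = 0) → ∀ g ∈ I, Z * g - g * Z ∈ I := by
    rintro Z hZ g ⟨Y, hY, h⟩
    obtain ⟨W, hW, hWZ⟩ := SpBlocksThetaSix.exists_mem_spanC_restrict_eq H hn heff ψ hself σ hreal hint h6 𝔤 hbr hΘ hΘ𝔤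
      hcomm hskew j Z (fun x y => by rw [← hω_apply, ← hω_apply]; exact hZ x y)
    refine (hmemI _).2 ⟨W * Y - Y * W, hNideal W hW Y hY, fun x => ?_⟩
    rw [LinearMap.sub_apply, Submodule.coe_sub, Module.End.mul_apply, Module.End.mul_apply, hWZ, h, h, hWZ, LinearMap.sub_apply,
      Module.End.mul_apply, Module.End.mul_apply]
  by_cases hI0 : I = ⊥
  · left
    intro Y hY x hx
    have hg : Y.restrict (fun x hx => hYT Y (hN hY) x hx) ∈ I := (hmemI _).2 ⟨Y, hY, fun x => rfl⟩
    rw [hI0, Submodule.mem_bot] at hg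
    have h := congrArg (fun g : Module.End ℂ ↥T => ((g ⟨x, hx⟩ : T) : ℂ ⊗[ℚ] V)) hg
    simpa using h
  · right
    intro g hg
    have hgI : g ∈ I := SymplecticIdealSix.mem_of_ne_bot ω hωnd hωalt hTT hTskew hP hQ hPmem hQmem hP3 I hIskew hI hI0
      (fun x y => by rw [hω_apply, hω_apply]; exact hg x y)
    exact (hmemI g).1 hgI

/-- **An element of `𝔤_ℂ` whose restriction to `T_j` commutes with the restrictions of a subspace `N` that restricts ONTO
`𝔰𝔭(T_j)` kills `T_j`** («`𝔰𝔭₆` has trivial centre», `SymplecticIdealSix.eq_zero_of_forall_bracket_eq_zero`); the tree's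
`SpBlocksTheta.apply_eq_zero_of_forall_commute` with `4 ↦ 6`. [cite: MoonenZarhin1999LowDim, §3 (3.1) and Lemma (3.4)]
[cite: Humphreys1972, §5.2] -/
theorem SpBlocksThetaSix.apply_eq_zero_of_forall_commute (H : HodgeStructure V n) (hn : n = 1) (heff : H.IsEffective)
    (ψ : H.Polarization)
    (hself : ∀ a : H.endAlg, LinearMap.IsAdjointPair ψ.form ψ.form (a : Module.End ℚ V) (a : Module.End ℚ V))
    (σ : ι → (H.endAlg →+* ℂ)) (hreal : ∀ i, (starRingEnd ℂ).comp (σ i) = σ i)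
    (hint : DirectSum.IsInternal fun i => H.eigenBlock (σ i)) (h6 : ∀ i, Module.finrank ℂ (H.eigenBlock (σ i)) = 6)
    (𝔤 : Submodule ℚ (Module.End ℚ V)) {Θ : Module.End ℂ (ℂ ⊗[ℚ] V)}
    (hΘ : ∀ p, ∀ x ∈ H.piece p (n - p), Θ x = ((2 * p - n : ℤ) : ℂ) • x)
    (hcomm : ∀ X ∈ 𝔤, ∀ a : H.endAlg, X * (a : Module.End ℚ V) = (a : Module.End ℚ V) * X)
    (hskew : ∀ X ∈ 𝔤, ∀ v w, ψ.form (X v) w + ψ.form v (X w) = 0) (j : ι)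
    (N : Submodule ℂ (Module.End ℂ (ℂ ⊗[ℚ] V)))
    (hNonto : ∀ g : Module.End ℂ ↥(H.eigenBlock (σ j)),
        (∀ x y : H.eigenBlock (σ j), ψ.form.baseChange ℂ ((g x : H.eigenBlock (σ j)) : ℂ ⊗[ℚ] V) y +
          ψ.form.baseChange ℂ (x : ℂ ⊗[ℚ] V) ((g y : H.eigenBlock (σ j)) : ℂ ⊗[ℚ] V) = 0) →
        ∃ Y ∈ N, ∀ x : H.eigenBlock (σ j), ((g x : H.eigenBlock (σ j)) : ℂ ⊗[ℚ] V) = Y x)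
    {Z : Module.End ℂ (ℂ ⊗[ℚ] V)} (hZ : Z ∈ spanC 𝔤) (hc : ∀ Y ∈ N, ∀ x ∈ H.eigenBlock (σ j), (Y * Z - Z * Y) x = 0)
    {x : ℂ ⊗[ℚ] V} (hx : x ∈ H.eigenBlock (σ j)) : Z x = 0 := by
  classical
  obtain ⟨hωnd, hωalt, TΘ, P, Q, hTΘ, hTT, hTskew, hP, hQ, hPmem, hQmem, hP3, hQ3⟩ :=
    SymplecticBlocksSix.exists_blockData H hn heff ψ hself σ hreal hint h6 hΘ j
  set T := H.eigenBlock (σ j) with hT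
  set ω : LinearMap.BilinForm ℂ ↥T := (ψ.form.baseChange ℂ).compl₁₂ T.subtype T.subtype with hω
  have hω_apply : ∀ x y : T, ω x y = ψ.form.baseChange ℂ (x : ℂ ⊗[ℚ] V) y := fun x y => rfl
  have hYT : ∀ Y ∈ spanC 𝔤, ∀ x ∈ T, Y x ∈ T := fun Y hY x hx => SpBlocksTheta.apply_mem_eigenBlock H σ hcomm hY j hx
  set ZT : Module.End ℂ ↥T := Z.restrict fun x hx => hYT Z hZ x hx with hZT
  have hZT_coe : ∀ x : T, ((ZT x : T) : ℂ ⊗[ℚ] V) = Z x := fun x => rfl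
  have hZTskew : ∀ x y : T, ω (ZT x) y + ω x (ZT y) = 0 := fun x y => by
    rw [hω_apply, hω_apply, hZT_coe, hZT_coe]
    exact ThetaSubalgebra.formBaseChange_add_eq_zero_of_mem_spanC ψ hskew hZ _ _
  have h0 : ZT = 0 := by
    refine SymplecticIdealSix.eq_zero_of_forall_bracket_eq_zero ω hωnd hωalt hTT hTskew hP hQ hPmem hQmem hP3 hZTskew fun W hW => ?_
    obtain ⟨Y, hY, hYW⟩ := hNonto W fun x y => by rw [← hω_apply, ← hω_apply]; exact hW x y
    refine LinearMap.ext fun y => Subtype.ext ?_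
    rw [LinearMap.sub_apply, Submodule.coe_sub, Module.End.mul_apply, Module.End.mul_apply, hYW, hZT_coe, hZT_coe, hYW,
      LinearMap.zero_apply, Submodule.coe_zero]
    have h := hc Y hY y y.2
    rwa [LinearMap.sub_apply, Module.End.mul_apply, Module.End.mul_apply] at h
  have h := hZT_coe ⟨x, hx⟩
  rw [h0, LinearMap.zero_apply, Submodule.coe_zero] at h
  exact h.symm

/-- **`𝔤_ℂ` is a SEMISIMPLE Lie algebra** (six-dimensional real blocks, `𝔤` admissible): `V_ℂ` is a faithful completely
reducible `𝔏`-module, so the radical is central (Lie's theorem, `Literature.Algebra.Lie.hasCentralRadical_of_complementedLattice`);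
a central element commutes on every block with `𝔤_ℂ|_{T_j} = 𝔰𝔭(T_j)` and therefore kills every block (trivial centre of `𝔰𝔭₆`);
Cartan's criterion. The tree's `SpBlocksTheta.isSemisimple` with `4 ↦ 6` (Moonen–Zarhin §1 «if `X` has no factors of Type 4
then `Hg(X)` is semi-simple»). [cite: MoonenZarhin1999LowDim, §3 (3.1) and Lemma (3.4)]
[cite: Deligne1982HodgeCycles, I §3 Prop. 3.4] [cite: Humphreys1972, §5.2] -/
theorem SpBlocksThetaSix.isSemisimple (H : HodgeStructure V n) (hn : n = 1) (heff : H.IsEffective) (ψ : H.Polarization)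
    (hself : ∀ a : H.endAlg, LinearMap.IsAdjointPair ψ.form ψ.form (a : Module.End ℚ V) (a : Module.End ℚ V))
    (σ : ι → (H.endAlg →+* ℂ)) (hreal : ∀ i, (starRingEnd ℂ).comp (σ i) = σ i)
    (hint : DirectSum.IsInternal fun i => H.eigenBlock (σ i)) (h6 : ∀ i, Module.finrank ℂ (H.eigenBlock (σ i)) = 6)
    (𝔤 : Submodule ℚ (Module.End ℚ V)) (hbr : ∀ X ∈ 𝔤, ∀ X' ∈ 𝔤, X * X' - X' * X ∈ 𝔤) {Θ : Module.End ℂ (ℂ ⊗[ℚ] V)}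
    (hΘ : ∀ p, ∀ x ∈ H.piece p (n - p), Θ x = ((2 * p - n : ℤ) : ℂ) • x) (hΘ𝔤 : Θ ∈ spanC 𝔤)
    (hcomm : ∀ X ∈ 𝔤, ∀ a : H.endAlg, X * (a : Module.End ℚ V) = (a : Module.End ℚ V) * X)
    (hskew : ∀ X ∈ 𝔤, ∀ v w, ψ.form (X v) w + ψ.form v (X w) = 0) :
    letI : LieRing (Module.End ℂ (ℂ ⊗[ℚ] V)) := LieRing.ofAssociativeRing
    ∀ (𝔏 : LieSubalgebra ℂ (Module.End ℂ (ℂ ⊗[ℚ] V))), 𝔏.toSubmodule = spanC 𝔤 → LieAlgebra.IsSemisimple ℂ 𝔏 := by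
  letI : LieRing (Module.End ℂ (ℂ ⊗[ℚ] V)) := LieRing.ofAssociativeRing
  intro 𝔏 h𝔏
  haveI := SpBlocksTheta.complementedLattice_lieSubmodule H hn heff ψ 𝔤 hΘ hΘ𝔤 hskew 𝔏 h𝔏
  haveI : Module.Finite ℂ 𝔏 := Module.Finite.of_injective 𝔏.toSubmodule.subtype Subtype.val_injective
  have hmem : ∀ Y : Module.End ℂ (ℂ ⊗[ℚ] V), Y ∈ spanC 𝔤 ↔ Y ∈ 𝔏 := fun Y => by
    rw [← LieSubalgebra.mem_toSubmodule, h𝔏]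
  -- the centre vanishes
  have hcenter : LieAlgebra.center ℂ 𝔏 = ⊥ := by
    rw [eq_bot_iff]
    intro Z hZ
    rw [LieSubmodule.mem_bot]
    have hZc : ∀ Y ∈ spanC 𝔤, Y * (Z : Module.End ℂ (ℂ ⊗[ℚ] V)) - (Z : Module.End ℂ (ℂ ⊗[ℚ] V)) * Y = 0 := by
      intro Y hY
      have h := (LieModule.mem_maxTrivSubmodule ℂ 𝔏 𝔏 Z).1 hZ ⟨Y, (hmem Y).1 hY⟩
      have h' := congrArg Subtype.val h
      rwa [LieSubalgebra.coe_bracket, LieRing.of_associative_ring_bracket] at h'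
    have hZ0 : (Z : Module.End ℂ (ℂ ⊗[ℚ] V)) = 0 := by
      refine LinearMap.ext fun v => ?_
      have hv : v ∈ ⨆ j, H.eigenBlock (σ j) := by
        rw [hint.submodule_iSup_eq_top]
        exact Submodule.mem_top
      rw [LinearMap.zero_apply]
      induction hv using Submodule.iSup_induction' with
      | mem j x hx =>
        exact SpBlocksThetaSix.apply_eq_zero_of_forall_commute H hn heff ψ hself σ hreal hint h6 𝔤 hΘ hcomm hskew j (spanC 𝔤)
          (SpBlocksThetaSix.exists_mem_spanC_restrict_eq H hn heff ψ hself σ hreal hint h6 𝔤 hbr hΘ hΘ𝔤 hcomm hskew j)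
          ((hmem _).2 Z.2) (fun Y hY y _ => by rw [hZc Y hY, LinearMap.zero_apply]) hx
      | zero => simp
      | add x y _ _ hx hy => rw [map_add, hx, hy, add_zero]
    exact Subtype.ext hZ0
  exact Literature.Algebra.Lie.isSemisimple_of_complementedLattice_of_center_eq_bot (k := ℂ) (L := 𝔏) (M := ℂ ⊗[ℚ] V) hcenter

/-! ### §3 The Goursat step: complementary ideals, no intertwiners between distinct blocks, supported lifts -/

/-- **The complementary ideal `N` of `M_i = ker c_i` in the semisimple Lie algebra `𝔤_ℂ`**, as a subspace of `End(V_ℂ)`: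
`N ⊆ 𝔤_ℂ` is an ideal, every element of `𝔤_ℂ` agrees on `T_i` with a unique element of `N`, and `[M_i, N] = 0` (Boolean
algebra of ideals of a semisimple Lie algebra, Mathlib; §2). The tree's `SpBlocksTheta.exists_complement_ideal` with `4 ↦ 6`. [cite: Humphreys1972, §5.2] [cite: MoonenZarhin1999LowDim, §3 (3.1) and Lemma (3.4)] -/
theorem SpBlocksThetaSix.exists_complement_ideal (H : HodgeStructure V n) (hn : n = 1) (heff : H.IsEffective)
    (ψ : H.Polarization)
    (hself : ∀ a : H.endAlg, LinearMap.IsAdjointPair ψ.form ψ.form (a : Module.End ℚ V) (a : Module.End ℚ V))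
    (σ : ι → (H.endAlg →+* ℂ)) (hreal : ∀ i, (starRingEnd ℂ).comp (σ i) = σ i)
    (hint : DirectSum.IsInternal fun i => H.eigenBlock (σ i)) (h6 : ∀ i, Module.finrank ℂ (H.eigenBlock (σ i)) = 6)
    (𝔤 : Submodule ℚ (Module.End ℚ V)) (hbr : ∀ X ∈ 𝔤, ∀ X' ∈ 𝔤, X * X' - X' * X ∈ 𝔤) {Θ : Module.End ℂ (ℂ ⊗[ℚ] V)}
    (hΘ : ∀ p, ∀ x ∈ H.piece p (n - p), Θ x = ((2 * p - n : ℤ) : ℂ) • x) (hΘ𝔤 : Θ ∈ spanC 𝔤)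
    (hcomm : ∀ X ∈ 𝔤, ∀ a : H.endAlg, X * (a : Module.End ℚ V) = (a : Module.End ℚ V) * X)
    (hskew : ∀ X ∈ 𝔤, ∀ v w, ψ.form (X v) w + ψ.form v (X w) = 0) (i : ι) :
    ∃ N : Submodule ℂ (Module.End ℂ (ℂ ⊗[ℚ] V)), N ≤ spanC 𝔤 ∧
      (∀ W ∈ spanC 𝔤, ∀ Y ∈ N, W * Y - Y * W ∈ N) ∧
      (∀ W ∈ spanC 𝔤, ∃ Y ∈ N, ∀ x ∈ H.eigenBlock (σ i), W x = Y x) ∧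
      (∀ Y ∈ N, (∀ x ∈ H.eigenBlock (σ i), Y x = 0) → Y = 0) ∧
      (∀ m ∈ spanC 𝔤, (∀ x ∈ H.eigenBlock (σ i), m x = 0) → ∀ Y ∈ N, m * Y - Y * m = 0) := by
  classical
  letI : LieRing (Module.End ℂ (ℂ ⊗[ℚ] V)) := LieRing.ofAssociativeRing
  subst hn
  obtain ⟨𝔏, h𝔏⟩ := SpBlocksTheta.exists_lieSubalgebra_eq_spanC (V := V) 𝔤 hbr
  haveI := SpBlocksThetaSix.isSemisimple H rfl heff ψ hself σ hreal hint h6 𝔤 hbr hΘ hΘ𝔤 hcomm hskew 𝔏 h𝔏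
  have hmem : ∀ Y : Module.End ℂ (ℂ ⊗[ℚ] V), Y ∈ spanC 𝔤 ↔ Y ∈ 𝔏 := fun Y => by
    rw [← LieSubalgebra.mem_toSubmodule, h𝔏]
  have hYT : ∀ Y ∈ spanC 𝔤, ∀ x ∈ H.eigenBlock (σ i), Y x ∈ H.eigenBlock (σ i) :=
    fun Y hY x hx => SpBlocksTheta.apply_mem_eigenBlock H σ hcomm hY i hx
  have hbr' : ∀ W Y : 𝔏, ((⁅W, Y⁆ : 𝔏) : Module.End ℂ (ℂ ⊗[ℚ] V)) =
      (W : Module.End ℂ (ℂ ⊗[ℚ] V)) * (Y : Module.End ℂ (ℂ ⊗[ℚ] V)) -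
        (Y : Module.End ℂ (ℂ ⊗[ℚ] V)) * (W : Module.End ℂ (ℂ ⊗[ℚ] V)) :=
    fun W Y => by rw [LieSubalgebra.coe_bracket, LieRing.of_associative_ring_bracket]
  -- the ideal `M` of elements killing `T_i`, and a complementary ideal `N`
  obtain ⟨M, hmemM⟩ : ∃ M : LieIdeal ℂ 𝔏,
      ∀ Y : 𝔏, Y ∈ M ↔ ∀ x ∈ H.eigenBlock (σ i), (Y : Module.End ℂ (ℂ ⊗[ℚ] V)) x = 0 :=
    ⟨{ toSubmodule :=
          { carrier := {Y : 𝔏 | ∀ x ∈ H.eigenBlock (σ i), (Y : Module.End ℂ (ℂ ⊗[ℚ] V)) x = 0}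
            zero_mem' := fun x _ => by simp
            add_mem' := fun {Y Y'} hY hY' x hx => by
              rw [AddMemClass.coe_add, LinearMap.add_apply, hY x hx, hY' x hx, add_zero]
            smul_mem' := fun c {Y} hY x hx => by
              rw [SetLike.val_smul, LinearMap.smul_apply, hY x hx, smul_zero] },
        lie_mem := fun {W Y} hY x hx => by
          have hY' : ∀ x ∈ H.eigenBlock (σ i), (Y : Module.End ℂ (ℂ ⊗[ℚ] V)) x = 0 := hY
          rw [hbr', LinearMap.sub_apply, Module.End.mul_apply, Module.End.mul_apply, hY' x hx, map_zero,
            hY' _ (hYT _ ((hmem _).2 W.2) x hx), sub_zero] }, fun Y => Iff.rfl⟩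
  obtain ⟨N, hc⟩ : ∃ N : LieIdeal ℂ 𝔏, IsCompl M N := ⟨Mᶜ, isCompl_compl⟩
  have hinf : ∀ Y : 𝔏, Y ∈ M → Y ∈ N → Y = 0 := fun Y h1 h2 => by
    have h : Y ∈ M ⊓ N := (LieSubmodule.mem_inf M N Y).2 ⟨h1, h2⟩
    rwa [hc.inf_eq_bot, LieSubmodule.mem_bot] at h
  have hsup : ∀ Y : 𝔏, ∃ m ∈ M, ∃ nn ∈ N, m + nn = Y := fun Y => by
    have h : Y ∈ M ⊔ N := by rw [hc.sup_eq_top]; exact LieSubmodule.mem_top Y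
    exact (LieSubmodule.mem_sup M N Y).1 h
  refine ⟨N.toSubmodule.map 𝔏.toSubmodule.subtype, ?_, ?_, ?_, ?_, ?_⟩
  · rintro _ ⟨y, -, rfl⟩
    exact (hmem _).2 y.2
  · rintro W hW _ ⟨y, hy, rfl⟩
    exact ⟨⁅(⟨W, (hmem W).1 hW⟩ : 𝔏), y⁆, N.lie_mem hy, hbr' _ _⟩
  · intro W hW
    obtain ⟨m, hm, nn, hnn, hsum⟩ := hsup ⟨W, (hmem W).1 hW⟩
    refine ⟨nn, ⟨nn, hnn, rfl⟩, fun x hx => ?_⟩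
    have h := congrArg (fun Y : 𝔏 => (Y : Module.End ℂ (ℂ ⊗[ℚ] V)) x) hsum
    simp only [AddMemClass.coe_add, LinearMap.add_apply] at h
    rw [(hmemM m).1 hm x hx, zero_add] at h
    exact h.symm
  · rintro _ ⟨y, hy, rfl⟩ h0
    have h := hinf y ((hmemM y).2 h0) hy
    rw [h]
    exact ZeroMemClass.coe_zero 𝔏
  · rintro m hm hm0 _ ⟨y, hy, rfl⟩
    have hmM : (⟨m, (hmem m).1 hm⟩ : 𝔏) ∈ M := (hmemM _).2 hm0
    have h0 : ⁅(⟨m, (hmem m).1 hm⟩ : 𝔏), y⁆ = 0 :=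
      hinf _ (by rw [← lie_skew]; exact M.neg_mem (M.lie_mem hmM)) (N.lie_mem hy)
    have h1 := congrArg (fun Y : 𝔏 => (Y : Module.End ℂ (ℂ ⊗[ℚ] V))) h0
    simp only [hbr', ZeroMemClass.coe_zero] at h1
    exact h1

omit [HodgeTensorFacts.{u, u}] in
/-- **A `ℂ`-linear `F : T_i → T_j` (`i ≠ j`) intertwining the restrictions of every `X_ℂ`, `X ∈ 𝔤`, vanishes**: its extension by
zero commutes with `𝔤`, hence lies in `E ⊗ ℂ` by descent (`ThetaSubalgebra.eq_zero_of_forall_commute_of_mapsTo_eigenBlock`), which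
carries no block into another. The tree's `SymplecticBlocks.eq_zero_of_equivariant` for an admissible algebra.
[cite: MoonenZarhin1999LowDim, §3 (3.1) and Lemma (3.4)] [cite: Hazama1983, §3 (pp. 305–306)] -/
theorem SpBlocksThetaSix.eq_zero_of_equivariant (H : HodgeStructure V n) (σ : ι → (H.endAlg →+* ℂ))
    (hint : DirectSum.IsInternal fun i => H.eigenBlock (σ i)) (h6 : ∀ i, Module.finrank ℂ (H.eigenBlock (σ i)) = 6)
    (𝔤 : Submodule ℚ (Module.End ℚ V)) {Θ : Module.End ℂ (ℂ ⊗[ℚ] V)}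
    (hΘ : ∀ p, ∀ x ∈ H.piece p (n - p), Θ x = ((2 * p - n : ℤ) : ℂ) • x) (hΘ𝔤 : Θ ∈ spanC 𝔤)
    (hcomm : ∀ X ∈ 𝔤, ∀ a : H.endAlg, X * (a : Module.End ℚ V) = (a : Module.End ℚ V) * X) {i j : ι}
    (hji : j ≠ i) (F : ↥(H.eigenBlock (σ i)) →ₗ[ℂ] ↥(H.eigenBlock (σ j)))
    (hF : ∀ (X : Module.End ℚ V) (hX : X ∈ 𝔤) (x : H.eigenBlock (σ i)),
      ((F ⟨X.baseChange ℂ x, SpBlocksTheta.apply_mem_eigenBlock H σ hcomm (baseChange_mem_spanC hX) i x.2⟩ :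
        H.eigenBlock (σ j)) : ℂ ⊗[ℚ] V) = X.baseChange ℂ ((F x : H.eigenBlock (σ j)) : ℂ ⊗[ℚ] V)) : F = 0 := by
  classical
  have hYT : ∀ X ∈ 𝔤, ∀ k, ∀ x ∈ H.eigenBlock (σ k), X.baseChange ℂ x ∈ H.eigenBlock (σ k) :=
    fun X hX k x hx => SpBlocksTheta.apply_mem_eigenBlock H σ hcomm (baseChange_mem_spanC hX) k hx
  have hdisj : Disjoint (H.eigenBlock (σ i)) (⨆ (k) (_ : k ≠ i), H.eigenBlock (σ k)) := iSupIndep_def.1 hint.submodule_iSupIndep i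
  have hcod : H.eigenBlock (σ i) ⊔ (⨆ (k) (_ : k ≠ i), H.eigenBlock (σ k)) = ⊤ := by
    rw [← hint.submodule_iSup_eq_top, iSup_split_single (fun k => H.eigenBlock (σ k)) i]
  have hcT : IsCompl (H.eigenBlock (σ i)) (⨆ (k) (_ : k ≠ i), H.eigenBlock (σ k)) := ⟨hdisj, codisjoint_iff.2 hcod⟩
  obtain ⟨Zx, hZx_left, hZx_right⟩ : ∃ Zx : Module.End ℂ (ℂ ⊗[ℚ] V),
      (∀ x (hx : x ∈ H.eigenBlock (σ i)), Zx x = F ⟨x, hx⟩) ∧ ∀ x ∈ (⨆ (k) (_ : k ≠ i), H.eigenBlock (σ k)), Zx x = 0 :=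
    ⟨(H.eigenBlock (σ j)).subtype ∘ₗ F ∘ₗ (H.eigenBlock (σ i)).projectionOnto _ hcT,
      fun x hx => by
        rw [LinearMap.comp_apply, LinearMap.comp_apply, Submodule.projectionOnto_apply_of_mem_left hcT hx, Submodule.coe_subtype],
      fun x hx => by
        rw [LinearMap.comp_apply, LinearMap.comp_apply, Submodule.projectionOnto_apply_of_mem_right hcT hx, map_zero, map_zero]⟩
  have hCstab : ∀ X ∈ 𝔤, ∀ x ∈ (⨆ (k) (_ : k ≠ i), H.eigenBlock (σ k)),
      X.baseChange ℂ x ∈ (⨆ (k) (_ : k ≠ i), H.eigenBlock (σ k)) := by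
    intro X hX x hx
    have hle : (⨆ (k) (_ : k ≠ i), H.eigenBlock (σ k)) ≤ Submodule.comap (X.baseChange ℂ) (⨆ (k) (_ : k ≠ i), H.eigenBlock (σ k)) := by
      refine iSup₂_le fun k hk y hy => ?_
      rw [Submodule.mem_comap]
      exact Submodule.mem_iSup_of_mem (p := fun k => ⨆ (_ : k ≠ i), H.eigenBlock (σ k)) k
        (Submodule.mem_iSup_of_mem (p := fun _ : k ≠ i => H.eigenBlock (σ k)) hk (hYT X hX k y hy))
    exact hle hx
  have hc' : ∀ X ∈ 𝔤, Zx * X.baseChange ℂ = X.baseChange ℂ * Zx := by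
    intro X hX
    refine LinearMap.ext fun v => ?_
    obtain ⟨a, ha, c, hcC, rfl⟩ := Submodule.mem_sup.1 (show v ∈ H.eigenBlock (σ i) ⊔ (⨆ (k) (_ : k ≠ i), H.eigenBlock (σ k)) by
      rw [hcod]; exact Submodule.mem_top)
    rw [Module.End.mul_apply, Module.End.mul_apply, map_add, map_add, map_add, map_add, hZx_right c hcC, map_zero, add_zero,
      hZx_right _ (hCstab X hX c hcC), add_zero, hZx_left a ha, hZx_left _ (hYT X hX i a ha)]
    exact hF X hX ⟨a, ha⟩
  have hσ : σ i ≠ σ j := by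
    intro h
    have hd : Disjoint (H.eigenBlock (σ i)) (H.eigenBlock (σ j)) := hint.submodule_iSupIndep.pairwiseDisjoint (Ne.symm hji)
    rw [← h, disjoint_self] at hd
    have h6i := h6 i
    rw [hd, finrank_bot] at h6i
    exact absurd h6i (by norm_num)
  refine LinearMap.ext fun x => Subtype.ext ?_
  rw [LinearMap.zero_apply, Submodule.coe_zero, ← hZx_left x.1 x.2]
  exact ThetaSubalgebra.eq_zero_of_forall_commute_of_mapsTo_eigenBlock H 𝔤 hΘ hΘ𝔤 hσ hc'
    (fun y hy => by rw [hZx_left y hy]; exact (F ⟨y, hy⟩).2) x.2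

/-- **THE GOURSAT STEP for an admissible algebra (Moonen–Zarhin (3.1)/(3.4) for the rigid factor `𝔰𝔭(T_i)`).** In the
six-dimensional real-block situation, for every admissible `𝔤`, every block `T_i` and every `ψ_ℂ|_{T_i}`-skew `ℂ`-linear
`g : T_i → T_i` there is `Y ∈ 𝔤_ℂ` with `Y|_{T_i} = g` and `Y|_{T_j} = 0` for all `j ≠ i`. Proof as in the tree's
`SpBlocksTheta.exists_mem_spanC_supported`: the ideal `N` complementary to `ker c_i` (§3) is supported on `T_i`, for
if it moved another block `T_j` then `c_j` would be injective on `N ≅ 𝔰𝔭(T_i)` and `ρ = c_j ∘ (c_i|_N)⁻¹` a bracket-preserving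
injection `𝔰𝔭(T_i) → End(T_j)` intertwining `ad Θ`; the witness theorem `SymplecticWitness.exists_equivariant_ne_zero` (the
standard representation is the only length-one representation of `𝔰𝔭`) gives a non-zero equivariant `T_i → T_j`, which
`SpBlocksThetaSix.eq_zero_of_equivariant` forbids. [cite: MoonenZarhin1999LowDim, §3 (3.1) and Lemma (3.4)]
[cite: Ribet1983, Thm. 1] [cite: Gordon1997, Thm. 6.3 (arXiv:alg-geom/9709030 p. 18)] [cite: Hazama1983, §3 (pp. 305–306)] -/
theorem SpBlocksThetaSix.exists_mem_spanC_supported (H : HodgeStructure V n) (hn : n = 1) (heff : H.IsEffective)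
    (ψ : H.Polarization)
    (hself : ∀ a : H.endAlg, LinearMap.IsAdjointPair ψ.form ψ.form (a : Module.End ℚ V) (a : Module.End ℚ V))
    (σ : ι → (H.endAlg →+* ℂ)) (hreal : ∀ i, (starRingEnd ℂ).comp (σ i) = σ i)
    (hint : DirectSum.IsInternal fun i => H.eigenBlock (σ i)) (h6 : ∀ i, Module.finrank ℂ (H.eigenBlock (σ i)) = 6)
    (𝔤 : Submodule ℚ (Module.End ℚ V)) (hbr : ∀ X ∈ 𝔤, ∀ X' ∈ 𝔤, X * X' - X' * X ∈ 𝔤) {Θ : Module.End ℂ (ℂ ⊗[ℚ] V)}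
    (hΘ : ∀ p, ∀ x ∈ H.piece p (n - p), Θ x = ((2 * p - n : ℤ) : ℂ) • x) (hΘ𝔤 : Θ ∈ spanC 𝔤)
    (hcomm : ∀ X ∈ 𝔤, ∀ a : H.endAlg, X * (a : Module.End ℚ V) = (a : Module.End ℚ V) * X)
    (hskew : ∀ X ∈ 𝔤, ∀ v w, ψ.form (X v) w + ψ.form v (X w) = 0) (i : ι) :
    ∀ g : Module.End ℂ ↥(H.eigenBlock (σ i)),
      (∀ x y : H.eigenBlock (σ i), ψ.form.baseChange ℂ ((g x : H.eigenBlock (σ i)) : ℂ ⊗[ℚ] V) y +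
        ψ.form.baseChange ℂ (x : ℂ ⊗[ℚ] V) ((g y : H.eigenBlock (σ i)) : ℂ ⊗[ℚ] V) = 0) →
      ∃ Y ∈ spanC 𝔤, (∀ x : H.eigenBlock (σ i), ((g x : H.eigenBlock (σ i)) : ℂ ⊗[ℚ] V) = Y x) ∧
        ∀ j, j ≠ i → ∀ x ∈ H.eigenBlock (σ j), Y x = 0 := by
  classical
  subst hn
  have hYT : ∀ Y ∈ spanC 𝔤, ∀ k, ∀ x ∈ H.eigenBlock (σ k), Y x ∈ H.eigenBlock (σ k) :=
    fun Y hY k x hx => SpBlocksTheta.apply_mem_eigenBlock H σ hcomm hY k hx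
  have hYskew : ∀ Y ∈ spanC 𝔤, ∀ x y, ψ.form.baseChange ℂ (Y x) y + ψ.form.baseChange ℂ x (Y y) = 0 :=
    fun Y hY => ThetaSubalgebra.formBaseChange_add_eq_zero_of_mem_spanC ψ hskew hY
  obtain ⟨N', hN'le, hN'ideal, hN'dec, hN'uniq, hMN⟩ :=
    SpBlocksThetaSix.exists_complement_ideal H rfl heff ψ hself σ hreal hint h6 𝔤 hbr hΘ hΘ𝔤 hcomm hskew i
  -- lifting a skew operator on `T_i` into `N'`
  have hliftN : ∀ g' : Module.End ℂ ↥(H.eigenBlock (σ i)),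
      (∀ x y : H.eigenBlock (σ i), ψ.form.baseChange ℂ ((g' x : H.eigenBlock (σ i)) : ℂ ⊗[ℚ] V) y +
        ψ.form.baseChange ℂ (x : ℂ ⊗[ℚ] V) ((g' y : H.eigenBlock (σ i)) : ℂ ⊗[ℚ] V) = 0) →
      ∃ Y ∈ N', ∀ x : H.eigenBlock (σ i), ((g' x : H.eigenBlock (σ i)) : ℂ ⊗[ℚ] V) = Y x := by
    intro g' hg'
    obtain ⟨W, hW, hWg⟩ := SpBlocksThetaSix.exists_mem_spanC_restrict_eq H rfl heff ψ hself σ hreal hint h6 𝔤 hbr hΘ hΘ𝔤 hcomm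
      hskew i g' hg'
    obtain ⟨Y, hY, hWY⟩ := hN'dec W hW
    exact ⟨Y, hY, fun x => by rw [hWg x, hWY _ x.2]⟩
  have huniqN : ∀ Y Y', Y ∈ N' → Y' ∈ N' → (∀ x ∈ H.eigenBlock (σ i), Y x = Y' x) → Y = Y' :=
    fun Y Y' hY hY' h => sub_eq_zero.1 (hN'uniq _ (N'.sub_mem hY hY') fun x hx => by rw [LinearMap.sub_apply, h x hx, sub_self])
  intro g hg
  -- either `N'` is supported on `T_i` (done), or it moves some other block `T_j` (impossible)
  by_cases hsupp : ∀ j, j ≠ i → ∀ Y ∈ N', ∀ x ∈ H.eigenBlock (σ j), Y x = 0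
  · obtain ⟨Y, hY, hg'⟩ := hliftN g hg
    exact ⟨Y, hN'le hY, hg', fun j hj x hx => hsupp j hj Y hY x hx⟩
  exfalso
  push Not at hsupp
  obtain ⟨j, hji, Y₀, hY₀, x₀, hx₀, hY₀x₀⟩ := hsupp
  -- `N'` restricts onto `𝔰𝔭(T_j)`, `M` kills `T_j`, and `c_j` is injective on `N'`
  have hNonto := (SpBlocksThetaSix.restrict_ideal_dichotomy H rfl heff ψ hself σ hreal hint h6 𝔤 hbr hΘ hΘ𝔤 hcomm hskew N' hN'le
    hN'ideal j).resolve_left (fun h => hY₀x₀ (h Y₀ hY₀ x₀ hx₀))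
  have hMj : ∀ m ∈ spanC 𝔤, (∀ x ∈ H.eigenBlock (σ i), m x = 0) → ∀ x ∈ H.eigenBlock (σ j), m x = 0 :=
    fun m hm hm0 x hx => SpBlocksThetaSix.apply_eq_zero_of_forall_commute H rfl heff ψ hself σ hreal hint h6 𝔤 hΘ hcomm hskew j N'
      hNonto hm (fun Y hY y _ => by
        have h := hMN m hm hm0 Y hY
        rw [← neg_sub, h, neg_zero, LinearMap.zero_apply]) hx
  have hinjN : ∀ Y ∈ N', (∀ x ∈ H.eigenBlock (σ j), Y x = 0) → Y = 0 := by
    -- the ideal `K = N' ∩ ker c_j`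
    obtain ⟨K, hmemK⟩ : ∃ K : Submodule ℂ (Module.End ℂ (ℂ ⊗[ℚ] V)), ∀ Y, Y ∈ K ↔ Y ∈ N' ∧ ∀ x ∈ H.eigenBlock (σ j), Y x = 0 :=
      ⟨{ carrier := {Y | Y ∈ N' ∧ ∀ x ∈ H.eigenBlock (σ j), Y x = 0}
         zero_mem' := ⟨N'.zero_mem, fun x _ => by simp⟩
         add_mem' := fun {Y Y'} hY hY' => ⟨N'.add_mem hY.1 hY'.1, fun x hx => by
           rw [LinearMap.add_apply, hY.2 x hx, hY'.2 x hx, add_zero]⟩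
         smul_mem' := fun c {Y} hY => ⟨N'.smul_mem c hY.1, fun x hx => by rw [LinearMap.smul_apply, hY.2 x hx, smul_zero]⟩ },
        fun Y => Iff.rfl⟩
    have hKle : K ≤ spanC 𝔤 := fun Y hY => hN'le ((hmemK Y).1 hY).1
    have hKideal : ∀ W ∈ spanC 𝔤, ∀ Y ∈ K, W * Y - Y * W ∈ K := fun W hW Y hY =>
      (hmemK _).2 ⟨hN'ideal W hW Y ((hmemK Y).1 hY).1, fun x hx => by
        rw [LinearMap.sub_apply, Module.End.mul_apply, Module.End.mul_apply, ((hmemK Y).1 hY).2 x hx, map_zero,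
          ((hmemK Y).1 hY).2 _ (hYT W hW j x hx), sub_zero]⟩
    rcases SpBlocksThetaSix.restrict_ideal_dichotomy H rfl heff ψ hself σ hreal hint h6 𝔤 hbr hΘ hΘ𝔤 hcomm hskew K hKle hKideal i
      with hK | hK
    · exact fun Y hY hYj => hN'uniq Y hY (hK Y ((hmemK Y).2 ⟨hY, hYj⟩))
    · exfalso
      apply hY₀x₀
      have hskew' : ∀ x y : H.eigenBlock (σ i),
          ψ.form.baseChange ℂ (((Y₀.restrict fun x hx => hYT _ (hN'le hY₀) i x hx) x : H.eigenBlock (σ i)) : ℂ ⊗[ℚ] V) y +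
            ψ.form.baseChange ℂ (x : ℂ ⊗[ℚ] V) (((Y₀.restrict fun x hx => hYT _ (hN'le hY₀) i x hx) y : H.eigenBlock (σ i)) :
              ℂ ⊗[ℚ] V) = 0 := fun x y => by
        rw [LinearMap.coe_restrict_apply, LinearMap.coe_restrict_apply]
        exact hYskew _ (hN'le hY₀) _ _
      obtain ⟨Yk, hYk, hYk'⟩ := hK _ hskew'
      have hyk : Y₀ = Yk := huniqN Y₀ Yk hY₀ ((hmemK Yk).1 hYk).1 fun x hx => by
        have h := hYk' ⟨x, hx⟩
        rwa [LinearMap.coe_restrict_apply] at h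
      rw [hyk]
      exact ((hmemK Yk).1 hYk).2 x₀ hx₀
  -- block data on `T_i` and `T_j`
  obtain ⟨hωnd, hωalt, TΘ, P, Q, hTΘ, hTT, hTskew, hP, hQ, hPmem, hQmem, hP3, hQ3⟩ :=
    SymplecticBlocksSix.exists_blockData H rfl heff ψ hself σ hreal hint h6 hΘ i
  obtain ⟨-, -, TΘj, -, -, hTΘj, hTTj, -⟩ := SymplecticBlocksSix.exists_blockData H rfl heff ψ hself σ hreal hint h6 hΘ j
  set ω : LinearMap.BilinForm ℂ ↥(H.eigenBlock (σ i)) :=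
    (ψ.form.baseChange ℂ).compl₁₂ (H.eigenBlock (σ i)).subtype (H.eigenBlock (σ i)).subtype with hω
  have hω_apply : ∀ x y : H.eigenBlock (σ i), ω x y = ψ.form.baseChange ℂ (x : ℂ ⊗[ℚ] V) y := fun x y => rfl
  clear_value ω
  have hP0 : P ≠ ⊥ := by
    intro h
    rw [h, finrank_bot] at hP3
    exact absurd hP3 (by norm_num)
  -- the skew operators on `T_i`
  obtain ⟨𝔰, hmem𝔰⟩ : ∃ 𝔰 : Submodule ℂ (Module.End ℂ ↥(H.eigenBlock (σ i))),
      ∀ Z, Z ∈ 𝔰 ↔ ∀ x y : H.eigenBlock (σ i), ω (Z x) y + ω x (Z y) = 0 :=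
    ⟨{ carrier := {Z | ∀ x y : H.eigenBlock (σ i), ω (Z x) y + ω x (Z y) = 0}
       zero_mem' := fun x y => by simp
       add_mem' := by
         intro Z Z' hZ hZ' x y
         simp only [LinearMap.add_apply, map_add]
         have h1 := hZ x y
         have h2 := hZ' x y
         linear_combination h1 + h2
       smul_mem' := by
         intro c Z hZ x y
         simp only [LinearMap.smul_apply, map_smul, smul_eq_mul]
         have h1 := hZ x y
         linear_combination c * h1 }, fun Z => Iff.rfl⟩
  -- the lift `𝔰 → N'` and the transport `ρ : End(T_i) → End(T_j)`
  have hlift : ∀ Z : 𝔰, ∃ Y, Y ∈ N' ∧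
      ∀ x : H.eigenBlock (σ i), ((((Z : Module.End ℂ ↥(H.eigenBlock (σ i))) x) : H.eigenBlock (σ i)) : ℂ ⊗[ℚ] V) = Y x :=
    fun Z => hliftN Z fun x y => by rw [← hω_apply, ← hω_apply]; exact (hmem𝔰 _).1 Z.2 x y
  choose lift hliftN_mem hlift_eq using hlift
  have hlift_eq' : ∀ (Z : Module.End ℂ ↥(H.eigenBlock (σ i))) (hZ : Z ∈ 𝔰) (x : H.eigenBlock (σ i)),
      ((Z x : H.eigenBlock (σ i)) : ℂ ⊗[ℚ] V) = lift ⟨Z, hZ⟩ x := fun Z hZ x => hlift_eq ⟨Z, hZ⟩ x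
  have hlift_unique : ∀ (Z : 𝔰) (Y : Module.End ℂ (ℂ ⊗[ℚ] V)), Y ∈ N' →
      (∀ x : H.eigenBlock (σ i), ((((Z : Module.End ℂ ↥(H.eigenBlock (σ i))) x) : H.eigenBlock (σ i)) : ℂ ⊗[ℚ] V) = Y x) →
      lift Z = Y :=
    fun Z Y hY h => huniqN _ _ (hliftN_mem Z) hY fun x hx => by rw [← hlift_eq Z ⟨x, hx⟩, h ⟨x, hx⟩]
  have hlift_add : ∀ Z Z' : 𝔰, lift (Z + Z') = lift Z + lift Z' :=
    fun Z Z' => hlift_unique _ _ (N'.add_mem (hliftN_mem Z) (hliftN_mem Z')) fun x => by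
      rw [Submodule.coe_add, LinearMap.add_apply, Submodule.coe_add, hlift_eq, hlift_eq, LinearMap.add_apply]
  have hlift_smul : ∀ (c : ℂ) (Z : 𝔰), lift (c • Z) = c • lift Z :=
    fun c Z => hlift_unique _ _ (N'.smul_mem c (hliftN_mem Z)) fun x => by
      rw [Submodule.coe_smul, LinearMap.smul_apply, Submodule.coe_smul, hlift_eq, LinearMap.smul_apply]
  have hliftTj : ∀ Z : 𝔰, ∀ x ∈ H.eigenBlock (σ j), lift Z x ∈ H.eigenBlock (σ j) :=
    fun Z x hx => hYT _ (hN'le (hliftN_mem Z)) j x hx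
  obtain ⟨ρ₀, hρ₀⟩ : ∃ ρ₀ : 𝔰 →ₗ[ℂ] Module.End ℂ ↥(H.eigenBlock (σ j)), ∀ (Z : 𝔰) (x : H.eigenBlock (σ j)),
      ((ρ₀ Z x : H.eigenBlock (σ j)) : ℂ ⊗[ℚ] V) = lift Z x :=
    ⟨{ toFun := fun Z => (lift Z).restrict (hliftTj Z)
       map_add' := fun Z Z' => LinearMap.ext fun x => Subtype.ext (by
         simp only [LinearMap.coe_restrict_apply, LinearMap.add_apply, hlift_add, Submodule.coe_add])
       map_smul' := fun c Z => LinearMap.ext fun x => Subtype.ext (by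
         simp only [LinearMap.coe_restrict_apply, LinearMap.smul_apply, hlift_smul, Submodule.coe_smul, RingHom.id_apply]) },
      fun Z x => rfl⟩
  obtain ⟨C, hC⟩ := Submodule.exists_isCompl (K := ℂ) (V := Module.End ℂ ↥(H.eigenBlock (σ i))) 𝔰
  obtain ⟨π𝔰, hπ𝔰⟩ : ∃ π𝔰 : Module.End ℂ ↥(H.eigenBlock (σ i)) →ₗ[ℂ] ↥𝔰, ∀ Z (hZ : Z ∈ 𝔰), π𝔰 Z = ⟨Z, hZ⟩ :=
    ⟨Submodule.projectionOnto (R := ℂ) (E := Module.End ℂ ↥(H.eigenBlock (σ i))) 𝔰 C hC, fun Z hZ =>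
      Submodule.projectionOnto_apply_of_mem_left hC hZ⟩
  obtain ⟨ρ, hρ⟩ : ∃ ρ : Module.End ℂ ↥(H.eigenBlock (σ i)) →ₗ[ℂ] Module.End ℂ ↥(H.eigenBlock (σ j)),
      ∀ Z (hZ : Z ∈ 𝔰) (x : H.eigenBlock (σ j)), ((ρ Z x : H.eigenBlock (σ j)) : ℂ ⊗[ℚ] V) = lift ⟨Z, hZ⟩ x :=
    ⟨ρ₀ ∘ₗ π𝔰, fun Z hZ x => by rw [LinearMap.comp_apply, hπ𝔰 Z hZ, hρ₀]⟩
  -- `ρ` on the restriction of an element of `𝔤_ℂ`: it is the `T_j`-restriction of the same element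
  have hskew𝔰 : ∀ (W : Module.End ℂ (ℂ ⊗[ℚ] V)) (hW : W ∈ spanC 𝔤), W.restrict (fun x hx => hYT W hW i x hx) ∈ 𝔰 :=
    fun W hW => (hmem𝔰 _).2 fun x y => by
      rw [hω_apply, hω_apply, LinearMap.coe_restrict_apply, LinearMap.coe_restrict_apply]
      exact hYskew W hW _ _
  have hρ_restrict : ∀ (W : Module.End ℂ (ℂ ⊗[ℚ] V)) (hW : W ∈ spanC 𝔤) (x : H.eigenBlock (σ j)),
      ((ρ (W.restrict fun x hx => hYT W hW i x hx) x : H.eigenBlock (σ j)) : ℂ ⊗[ℚ] V) = W x := by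
    intro W hW x
    obtain ⟨Y, hY, hWY⟩ := hN'dec W hW
    have hl : lift ⟨_, hskew𝔰 W hW⟩ = Y := hlift_unique _ Y hY fun y => by rw [LinearMap.coe_restrict_apply, hWY _ y.2]
    have hWYj : ∀ y ∈ H.eigenBlock (σ j), (W - Y) y = 0 :=
      hMj (W - Y) (Submodule.sub_mem _ hW (hN'le hY)) fun y hy => by rw [LinearMap.sub_apply, hWY y hy, sub_self]
    have h := hWYj x x.2
    rw [LinearMap.sub_apply, sub_eq_zero] at h
    rw [hρ _ (hskew𝔰 W hW), hl, h]
  -- hypotheses of the witness theorem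
  have hρbr : ∀ Z ∈ 𝔰, ∀ Z' ∈ 𝔰, ρ (Z * Z' - Z' * Z) = ρ Z * ρ Z' - ρ Z' * ρ Z := by
    intro Z hZ Z' hZ'
    have h𝔰br : Z * Z' - Z' * Z ∈ 𝔰 := (hmem𝔰 _).2 fun x y => by
      simp only [LinearMap.sub_apply, Module.End.mul_apply, map_sub, LinearMap.sub_apply]
      have h1 := (hmem𝔰 Z).1 hZ (Z' x) y
      have h2 := (hmem𝔰 Z').1 hZ' x (Z y)
      have h3 := (hmem𝔰 Z').1 hZ' (Z x) y
      have h6' := (hmem𝔰 Z).1 hZ x (Z' y)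
      linear_combination h1 - h3 + h6' - h2
    have hl : lift ⟨_, h𝔰br⟩ = lift ⟨Z, hZ⟩ * lift ⟨Z', hZ'⟩ - lift ⟨Z', hZ'⟩ * lift ⟨Z, hZ⟩ :=
      hlift_unique _ _ (hN'ideal _ (hN'le (hliftN_mem _)) _ (hliftN_mem _)) fun x => by
        change (((Z * Z' - Z' * Z) x : H.eigenBlock (σ i)) : ℂ ⊗[ℚ] V) = _
        rw [LinearMap.sub_apply, Submodule.coe_sub, Module.End.mul_apply, Module.End.mul_apply, hlift_eq' Z hZ, hlift_eq' Z' hZ',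
          hlift_eq' Z' hZ', hlift_eq' Z hZ, LinearMap.sub_apply, Module.End.mul_apply, Module.End.mul_apply]
    refine LinearMap.ext fun x => Subtype.ext ?_
    rw [hρ _ h𝔰br, hl]
    simp only [LinearMap.sub_apply, Submodule.coe_sub, Module.End.mul_apply, hρ _ hZ, hρ _ hZ']
  have hTΘ𝔰 : TΘ ∈ 𝔰 := (hmem𝔰 _).2 hTskew
  have hρTΘ : ρ TΘ = TΘj := by
    have h := hρ_restrict Θ hΘ𝔤
    have hres : Θ.restrict (fun x hx => hYT Θ hΘ𝔤 i x hx) = TΘ :=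
      LinearMap.ext fun x => Subtype.ext (by rw [LinearMap.coe_restrict_apply, hTΘ])
    rw [hres] at h
    exact LinearMap.ext fun x => Subtype.ext (by rw [h, hTΘj])
  have hρΘ : ∀ Z ∈ 𝔰, ρ (TΘ * Z - Z * TΘ) = TΘj * ρ Z - ρ Z * TΘj := fun Z hZ => by
    rw [hρbr TΘ hTΘ𝔰 Z hZ, hρTΘ]
  have hinjρ : ∀ Z ∈ 𝔰, ρ Z = 0 → Z = 0 := by
    intro Z hZ h0
    have hl0 : lift ⟨Z, hZ⟩ = 0 := hinjN _ (hliftN_mem _) fun x hx => by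
      have h := congrArg (fun f : Module.End ℂ ↥(H.eigenBlock (σ j)) => ((f ⟨x, hx⟩ : H.eigenBlock (σ j)) : ℂ ⊗[ℚ] V)) h0
      simp only [LinearMap.zero_apply, Submodule.coe_zero] at h
      rw [← h, hρ _ hZ]
    refine LinearMap.ext fun x => Subtype.ext ?_
    rw [hlift_eq' Z hZ, hl0, LinearMap.zero_apply, LinearMap.zero_apply, Submodule.coe_zero]
  -- the witness: a non-zero `ρ`-equivariant `F : T_i → T_j` — which must vanish
  obtain ⟨F, hF0, hF⟩ := SymplecticWitness.exists_equivariant_ne_zero ω hωnd hωalt hTT hTskew hP hQ hPmem hQmem hP0 𝔰 hmem𝔰 hTTj ρ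
    hρbr hρΘ hinjρ
  refine hF0 (SpBlocksThetaSix.eq_zero_of_equivariant H σ hint h6 𝔤 hΘ hΘ𝔤 hcomm hji F fun X hX x => ?_)
  have hW : X.baseChange ℂ ∈ spanC 𝔤 := baseChange_mem_spanC hX
  have h := congrArg (fun f : ↥(H.eigenBlock (σ i)) →ₗ[ℂ] ↥(H.eigenBlock (σ j)) => ((f x : H.eigenBlock (σ j)) : ℂ ⊗[ℚ] V))
    (hF _ (hskew𝔰 _ hW))
  simp only [LinearMap.comp_apply] at h
  rw [hρ_restrict _ hW] at h
  exact h.symm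

/-! ### §4 `𝔤_ℂ = ⊕_i 𝔰𝔭(T_i)`, uniqueness `𝔤 = Lie Hg(H)`, and Theorem L in the word model -/

/-- **`𝔤_ℂ ⊇ ⊕_i 𝔰𝔭(T_i)`: every block-preserving `ψ_ℂ`-skew operator lies in `𝔤_ℂ`** (sum of the supported lifts of its
restrictions, §3). With the converse (`SpBlocksTheta.apply_mem_eigenBlock`) this is
`𝔤_ℂ = 𝔰𝔭_E(V, ψ)_ℂ = ⊕_i 𝔰𝔭(T_i, ψ_ℂ|_{T_i})` — Ribet 1983 Thm. 1 «`Hg(A) = Res_{F/ℚ} Sp(W_0, ψ)`,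
`Hg(A, ℂ) ≃ ∏_σ Sp(U_σ, ψ_σ)`» (relative dimension three) in Lie form, for EVERY admissible rational algebra (Deligne's
minimality). [cite: Ribet1983, Thm. 1] [cite: Gordon1997, Thm. 6.3 (arXiv:alg-geom/9709030 p. 18)]
[cite: MoonenZarhin1999LowDim, §3 (3.1) and Lemma (3.4)] [cite: Deligne1982HodgeCycles, I §3 Prop. 3.4] -/
theorem SpBlocksThetaSix.mem_spanC_of_mapsTo_of_skew [Fintype ι] (H : HodgeStructure V n) (hn : n = 1) (heff : H.IsEffective)
    (ψ : H.Polarization)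
    (hself : ∀ a : H.endAlg, LinearMap.IsAdjointPair ψ.form ψ.form (a : Module.End ℚ V) (a : Module.End ℚ V))
    (σ : ι → (H.endAlg →+* ℂ)) (hreal : ∀ i, (starRingEnd ℂ).comp (σ i) = σ i)
    (hint : DirectSum.IsInternal fun i => H.eigenBlock (σ i)) (h6 : ∀ i, Module.finrank ℂ (H.eigenBlock (σ i)) = 6)
    (𝔤 : Submodule ℚ (Module.End ℚ V)) (hbr : ∀ X ∈ 𝔤, ∀ X' ∈ 𝔤, X * X' - X' * X ∈ 𝔤) {Θ : Module.End ℂ (ℂ ⊗[ℚ] V)}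
    (hΘ : ∀ p, ∀ x ∈ H.piece p (n - p), Θ x = ((2 * p - n : ℤ) : ℂ) • x) (hΘ𝔤 : Θ ∈ spanC 𝔤)
    (hcomm : ∀ X ∈ 𝔤, ∀ a : H.endAlg, X * (a : Module.End ℚ V) = (a : Module.End ℚ V) * X)
    (hskew : ∀ X ∈ 𝔤, ∀ v w, ψ.form (X v) w + ψ.form v (X w) = 0) {Y : Module.End ℂ (ℂ ⊗[ℚ] V)}
    (hYT : ∀ i, Set.MapsTo Y (H.eigenBlock (σ i)) (H.eigenBlock (σ i)))
    (hYskew : ∀ x y, ψ.form.baseChange ℂ (Y x) y + ψ.form.baseChange ℂ x (Y y) = 0) : Y ∈ spanC 𝔤 := by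
  classical
  have hsk : ∀ i, ∀ x y : H.eigenBlock (σ i),
      ψ.form.baseChange ℂ (((Y.restrict fun x hx => hYT i hx) x : H.eigenBlock (σ i)) : ℂ ⊗[ℚ] V) y +
        ψ.form.baseChange ℂ (x : ℂ ⊗[ℚ] V) (((Y.restrict fun x hx => hYT i hx) y : H.eigenBlock (σ i)) : ℂ ⊗[ℚ] V) = 0 :=
    fun i x y => by rw [LinearMap.coe_restrict_apply, LinearMap.coe_restrict_apply]; exact hYskew _ _
  choose L hLmem hLeq hLzero using fun i =>
    SpBlocksThetaSix.exists_mem_spanC_supported H hn heff ψ hself σ hreal hint h6 𝔤 hbr hΘ hΘ𝔤 hcomm hskew i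
      (Y.restrict fun x hx => hYT i hx) (hsk i)
  have hsum : Y = ∑ i, L i := by
    refine LinearMap.ext fun v => ?_
    have hv : v ∈ ⨆ j, H.eigenBlock (σ j) := by
      rw [hint.submodule_iSup_eq_top]
      exact Submodule.mem_top
    induction hv using Submodule.iSup_induction' with
    | mem j x hx =>
      rw [LinearMap.sum_apply, Finset.sum_eq_single j (fun i _ hij => hLzero i j (Ne.symm hij) x hx)
        (fun h => absurd (Finset.mem_univ j) h)]
      have h := hLeq j ⟨x, hx⟩
      rwa [LinearMap.coe_restrict_apply] at h
    | zero => simp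
    | add x y _ _ hx hy => rw [map_add, map_add, hx, hy]
  rw [hsum]
  exact Submodule.sum_mem _ fun i _ => hLmem i

/-- **`𝔤_ℂ = 𝔰𝔭_E(V, ψ)_ℂ`, block form** (six-dimensional real blocks): `Y ∈ 𝔤_ℂ` iff `Y` preserves every block and is
`ψ_ℂ`-skew. [cite: Ribet1983, Thm. 1] [cite: Gordon1997, Thm. 6.3 (arXiv:alg-geom/9709030 p. 18)] [cite: Hazama1983, §3 (pp. 305–306)] -/
theorem SpBlocksThetaSix.mem_spanC_iff_mapsTo_and_skew [Fintype ι] (H : HodgeStructure V n) (hn : n = 1) (heff : H.IsEffective)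
    (ψ : H.Polarization)
    (hself : ∀ a : H.endAlg, LinearMap.IsAdjointPair ψ.form ψ.form (a : Module.End ℚ V) (a : Module.End ℚ V))
    (σ : ι → (H.endAlg →+* ℂ)) (hreal : ∀ i, (starRingEnd ℂ).comp (σ i) = σ i)
    (hint : DirectSum.IsInternal fun i => H.eigenBlock (σ i)) (h6 : ∀ i, Module.finrank ℂ (H.eigenBlock (σ i)) = 6)
    (𝔤 : Submodule ℚ (Module.End ℚ V)) (hbr : ∀ X ∈ 𝔤, ∀ X' ∈ 𝔤, X * X' - X' * X ∈ 𝔤) {Θ : Module.End ℂ (ℂ ⊗[ℚ] V)}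
    (hΘ : ∀ p, ∀ x ∈ H.piece p (n - p), Θ x = ((2 * p - n : ℤ) : ℂ) • x) (hΘ𝔤 : Θ ∈ spanC 𝔤)
    (hcomm : ∀ X ∈ 𝔤, ∀ a : H.endAlg, X * (a : Module.End ℚ V) = (a : Module.End ℚ V) * X)
    (hskew : ∀ X ∈ 𝔤, ∀ v w, ψ.form (X v) w + ψ.form v (X w) = 0) (Y : Module.End ℂ (ℂ ⊗[ℚ] V)) :
    Y ∈ spanC 𝔤 ↔
      (∀ i, Set.MapsTo Y (H.eigenBlock (σ i)) (H.eigenBlock (σ i))) ∧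
      (∀ x y, ψ.form.baseChange ℂ (Y x) y + ψ.form.baseChange ℂ x (Y y) = 0) :=
  ⟨fun hY => ⟨fun i => fun _ hx => SpBlocksTheta.apply_mem_eigenBlock H σ hcomm hY i hx,
      ThetaSubalgebra.formBaseChange_add_eq_zero_of_mem_spanC ψ hskew hY⟩,
    fun ⟨hT, hs⟩ => SpBlocksThetaSix.mem_spanC_of_mapsTo_of_skew H hn heff ψ hself σ hreal hint h6 𝔤 hbr hΘ hΘ𝔤 hcomm hskew hT hs⟩

/-- **`𝔤 = 𝔰𝔭_E(V, ψ)`, rational form**: a rational `X` lies in `𝔤` iff it commutes with every Hodge endomorphism and is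
`ψ`-skew (descent `X ∈ 𝔤 ↔ X_ℂ ∈ 𝔤_ℂ`). [cite: Ribet1983, Thm. 1] [cite: Gordon1997, Thm. 6.3 (arXiv:alg-geom/9709030 p. 18)]
[cite: Deligne1982HodgeCycles, I §3 Prop. 3.4] -/
theorem SpBlocksThetaSix.mem_iff_commute_and_skew [Fintype ι] (H : HodgeStructure V n) (hn : n = 1) (heff : H.IsEffective)
    (ψ : H.Polarization)
    (hself : ∀ a : H.endAlg, LinearMap.IsAdjointPair ψ.form ψ.form (a : Module.End ℚ V) (a : Module.End ℚ V))
    (σ : ι → (H.endAlg →+* ℂ)) (hreal : ∀ i, (starRingEnd ℂ).comp (σ i) = σ i)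
    (hint : DirectSum.IsInternal fun i => H.eigenBlock (σ i)) (h6 : ∀ i, Module.finrank ℂ (H.eigenBlock (σ i)) = 6)
    (𝔤 : Submodule ℚ (Module.End ℚ V)) (hbr : ∀ X ∈ 𝔤, ∀ X' ∈ 𝔤, X * X' - X' * X ∈ 𝔤) {Θ : Module.End ℂ (ℂ ⊗[ℚ] V)}
    (hΘ : ∀ p, ∀ x ∈ H.piece p (n - p), Θ x = ((2 * p - n : ℤ) : ℂ) • x) (hΘ𝔤 : Θ ∈ spanC 𝔤)
    (hcomm : ∀ X ∈ 𝔤, ∀ a : H.endAlg, X * (a : Module.End ℚ V) = (a : Module.End ℚ V) * X)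
    (hskew : ∀ X ∈ 𝔤, ∀ v w, ψ.form (X v) w + ψ.form v (X w) = 0) (X : Module.End ℚ V) :
    X ∈ 𝔤 ↔
      (∀ a : H.endAlg, X * (a : Module.End ℚ V) = (a : Module.End ℚ V) * X) ∧
      (∀ v w, ψ.form (X v) w + ψ.form v (X w) = 0) := by
  refine ⟨fun hX => ⟨hcomm X hX, hskew X hX⟩, fun ⟨hc, hs⟩ => ?_⟩
  rw [mem_iff_baseChange_mem_spanC]
  exact SpBlocksThetaSix.mem_spanC_of_mapsTo_of_skew H hn heff ψ hself σ hreal hint h6 𝔤 hbr hΘ hΘ𝔤 hcomm hskew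
    (fun i => ThetaSubalgebra.mapsTo_baseChange_of_commute H σ hc i)
    (ThetaSubalgebra.formBaseChange_add_eq_zero_of_skew ψ hs)

/-- **UNIQUENESS: `𝔤 = Lie Hg(H)`** — the Lie algebra of the Hodge group is the ONLY rational bracket-closed subspace of
`𝔰𝔭_E(V, ψ)` whose complexification contains the Hodge operator, in the six-dimensional real-block situation (both are
`𝔰𝔭_E(V, ψ)`: `Lie Hg` itself is admissible — it commutes with `E`, is `ψ`-skew and `Θ ∈ Lie Hg ⊗ ℂ`). Deligne's minimality
principle (LNM 900 I Prop. 3.4: `MT` is the smallest `ℚ`-group whose complex points contain `μ(𝔾_m)`) in Lie form; for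
`H = H¹(A)`, `End⁰A = F` totally real with `dim A = 3[F:ℚ]`: «`Hg(A) = Res_{F/ℚ} Sp(W_0, ψ)`» (Ribet 1983 Thm. 1, `d/e = 3`).
[cite: Deligne1982HodgeCycles, I §3 Prop. 3.4] [cite: Ribet1983, Thm. 1] [cite: Gordon1997, Thm. 6.3 (arXiv:alg-geom/9709030 p. 18)] -/
theorem SpBlocksThetaSix.eq_hodgeLie [Fintype ι] (H : HodgeStructure V n) (hn : n = 1) (heff : H.IsEffective)
    (ψ : H.Polarization)
    (hself : ∀ a : H.endAlg, LinearMap.IsAdjointPair ψ.form ψ.form (a : Module.End ℚ V) (a : Module.End ℚ V))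
    (σ : ι → (H.endAlg →+* ℂ)) (hreal : ∀ i, (starRingEnd ℂ).comp (σ i) = σ i)
    (hint : DirectSum.IsInternal fun i => H.eigenBlock (σ i)) (h6 : ∀ i, Module.finrank ℂ (H.eigenBlock (σ i)) = 6)
    (𝔤 : Submodule ℚ (Module.End ℚ V)) (hbr : ∀ X ∈ 𝔤, ∀ X' ∈ 𝔤, X * X' - X' * X ∈ 𝔤) {Θ : Module.End ℂ (ℂ ⊗[ℚ] V)}
    (hΘ : ∀ p, ∀ x ∈ H.piece p (n - p), Θ x = ((2 * p - n : ℤ) : ℂ) • x) (hΘ𝔤 : Θ ∈ spanC 𝔤)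
    (hcomm : ∀ X ∈ 𝔤, ∀ a : H.endAlg, X * (a : Module.End ℚ V) = (a : Module.End ℚ V) * X)
    (hskew : ∀ X ∈ 𝔤, ∀ v w, ψ.form (X v) w + ψ.form v (X w) = 0) : 𝔤 = H.hodgeLie := by
  have hΘh : Θ ∈ spanC H.hodgeLie := by
    rw [← hodgeLieC_eq_spanC]
    exact H.mem_hodgeLieC_of_forall_piece hΘ
  ext X
  rw [SpBlocksThetaSix.mem_iff_commute_and_skew H hn heff ψ hself σ hreal hint h6 𝔤 hbr hΘ hΘ𝔤 hcomm hskew,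
    SpBlocksThetaSix.mem_iff_commute_and_skew H hn heff ψ hself σ hreal hint h6 H.hodgeLie
      (fun X hX X' hX' => H.commutator_mem_hodgeLie hX hX') hΘ hΘh (fun X hX a => H.commute_of_mem_hodgeLie hX a)
      (fun X hX v w => form_apply_add_eq_zero_of_mem_hodgeLie ψ hX v w)]

/-- **`𝔤_ℂ = Lie Hg(H) ⊗ ℂ`** (six-dimensional real blocks). [cite: Deligne1982HodgeCycles, I §3 Prop. 3.4]
[cite: Ribet1983, Thm. 1] [cite: Gordon1997, Thm. 6.3 (arXiv:alg-geom/9709030 p. 18)] -/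
theorem SpBlocksThetaSix.spanC_eq_hodgeLieC [Fintype ι] (H : HodgeStructure V n) (hn : n = 1) (heff : H.IsEffective)
    (ψ : H.Polarization)
    (hself : ∀ a : H.endAlg, LinearMap.IsAdjointPair ψ.form ψ.form (a : Module.End ℚ V) (a : Module.End ℚ V))
    (σ : ι → (H.endAlg →+* ℂ)) (hreal : ∀ i, (starRingEnd ℂ).comp (σ i) = σ i)
    (hint : DirectSum.IsInternal fun i => H.eigenBlock (σ i)) (h6 : ∀ i, Module.finrank ℂ (H.eigenBlock (σ i)) = 6)
    (𝔤 : Submodule ℚ (Module.End ℚ V)) (hbr : ∀ X ∈ 𝔤, ∀ X' ∈ 𝔤, X * X' - X' * X ∈ 𝔤) {Θ : Module.End ℂ (ℂ ⊗[ℚ] V)}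
    (hΘ : ∀ p, ∀ x ∈ H.piece p (n - p), Θ x = ((2 * p - n : ℤ) : ℂ) • x) (hΘ𝔤 : Θ ∈ spanC 𝔤)
    (hcomm : ∀ X ∈ 𝔤, ∀ a : H.endAlg, X * (a : Module.End ℚ V) = (a : Module.End ℚ V) * X)
    (hskew : ∀ X ∈ 𝔤, ∀ v w, ψ.form (X v) w + ψ.form v (X w) = 0) : spanC 𝔤 = H.hodgeLieC := by
  rw [SpBlocksThetaSix.eq_hodgeLie H hn heff ψ hself σ hreal hint h6 𝔤 hbr hΘ hΘ𝔤 hcomm hskew, hodgeLieC_eq_spanC]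

/-- **`Lie Hg(H) ⊗ ℂ = 𝔰𝔭_E(V, ψ)_ℂ = ⊕_i 𝔰𝔭(T_i) ≅ 𝔰𝔭₆^{#blocks}`** (six-dimensional real blocks): `Y ∈ Lie Hg ⊗ ℂ` iff `Y`
preserves every block and is `ψ_ℂ`-skew. Ribet 1983 Thm. 1: «`Hg(A) = Lf(A)`», i.e. «`Hg(A, ℂ) ≃ ∏_σ Sp(U_σ, ψ_σ)`» (Gordon
p. 18) for `End⁰A = F` totally real and `dim A / [F:ℚ] = 3`. [cite: Ribet1983, Thm. 1] [cite: Gordon1997, Thm. 6.3 (arXiv:alg-geom/9709030 p. 18)]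
[cite: MoonenZarhin1999LowDim, §3 (3.1) and Lemma (3.4)] -/
theorem SpBlocksThetaSix.mem_hodgeLieC_iff_mapsTo_and_skew [Fintype ι] (H : HodgeStructure V n) (hn : n = 1)
    (heff : H.IsEffective) (ψ : H.Polarization)
    (hself : ∀ a : H.endAlg, LinearMap.IsAdjointPair ψ.form ψ.form (a : Module.End ℚ V) (a : Module.End ℚ V))
    (σ : ι → (H.endAlg →+* ℂ)) (hreal : ∀ i, (starRingEnd ℂ).comp (σ i) = σ i)
    (hint : DirectSum.IsInternal fun i => H.eigenBlock (σ i)) (h6 : ∀ i, Module.finrank ℂ (H.eigenBlock (σ i)) = 6)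
    (Y : Module.End ℂ (ℂ ⊗[ℚ] V)) :
    Y ∈ H.hodgeLieC ↔
      (∀ i, Set.MapsTo Y (H.eigenBlock (σ i)) (H.eigenBlock (σ i))) ∧
      (∀ x y, ψ.form.baseChange ℂ (Y x) y + ψ.form.baseChange ℂ x (Y y) = 0) := by
  obtain ⟨Θ, hΘ⟩ := exists_hodgeTheta H
  have hΘh : Θ ∈ spanC H.hodgeLie := by
    rw [← hodgeLieC_eq_spanC]
    exact H.mem_hodgeLieC_of_forall_piece hΘ
  rw [hodgeLieC_eq_spanC]
  exact SpBlocksThetaSix.mem_spanC_iff_mapsTo_and_skew H hn heff ψ hself σ hreal hint h6 H.hodgeLie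
    (fun X hX X' hX' => H.commutator_mem_hodgeLie hX hX') hΘ hΘh (fun X hX a => H.commute_of_mem_hodgeLie hX a)
    (fun X hX v w => form_apply_add_eq_zero_of_mem_hodgeLie ψ hX v w) Y

/-- **`Lie Hg(H) = 𝔰𝔭_E(V, ψ)`, rational form** (six-dimensional real blocks): `X ∈ Lie Hg(H)` iff `X` commutes with `E` and
is `ψ`-skew («`Hg(A) = Lf(A) = Res_{F/ℚ} Sp(W_0, ψ)`», Ribet 1983 Thm. 1 for `d/e = 3`). [cite: Ribet1983, Thm. 1] [cite: Gordon1997, Thm. 6.3 (arXiv:alg-geom/9709030 p. 18)] -/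
theorem SpBlocksThetaSix.mem_hodgeLie_iff_commute_and_skew [Fintype ι] (H : HodgeStructure V n) (hn : n = 1)
    (heff : H.IsEffective) (ψ : H.Polarization)
    (hself : ∀ a : H.endAlg, LinearMap.IsAdjointPair ψ.form ψ.form (a : Module.End ℚ V) (a : Module.End ℚ V))
    (σ : ι → (H.endAlg →+* ℂ)) (hreal : ∀ i, (starRingEnd ℂ).comp (σ i) = σ i)
    (hint : DirectSum.IsInternal fun i => H.eigenBlock (σ i)) (h6 : ∀ i, Module.finrank ℂ (H.eigenBlock (σ i)) = 6)
    (X : Module.End ℚ V) :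
    X ∈ H.hodgeLie ↔
      (∀ a : H.endAlg, X * (a : Module.End ℚ V) = (a : Module.End ℚ V) * X) ∧
      (∀ v w, ψ.form (X v) w + ψ.form v (X w) = 0) := by
  obtain ⟨Θ, hΘ⟩ := exists_hodgeTheta H
  have hΘh : Θ ∈ spanC H.hodgeLie := by
    rw [← hodgeLieC_eq_spanC]
    exact H.mem_hodgeLieC_of_forall_piece hΘ
  exact SpBlocksThetaSix.mem_iff_commute_and_skew H hn heff ψ hself σ hreal hint h6 H.hodgeLie
    (fun X hX X' hX' => H.commutator_mem_hodgeLie hX hX') hΘ hΘh (fun X hX a => H.commute_of_mem_hodgeLie hX a)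
    (fun X hX v w => form_apply_add_eq_zero_of_mem_hodgeLie ψ hX v w) X

section AnnLie

open Literature.RepresentationTheory.GeneralLinear Literature.NumberTheory.DiophantineGeometry

/-- **Theorem L (invariance of rational tensors under `𝔰𝔭_E(V, ψ)_ℂ = ⊕_i 𝔰𝔭(T_i)`, six-dimensional real blocks).** Let
`H` be effective polarized of weight one with `E = End_Hdg(V)` `ψ`-self-adjoint and `V_ℂ = ⊕_i T_i` an internal
decomposition into SIX-dimensional eigenblocks of real characters of `E` (the `H¹` of an abelian variety `A` with
`End⁰A` a totally real field of degree `dim A / 3`). Let `q` be a RATIONAL coefficient tensor (letters: slots `Fin m` × a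
`ℚ`-basis `eQ` of `V`) killed — slice by slice, diagonally — by the matrix of the Hodge operator `Θ`. Then `q` is killed by
the matrix of EVERY block-preserving `ψ_ℂ`-skew operator `Y`. Proof: the rational Lie algebra `𝔞 ⊆ 𝔰𝔭_E(V, ψ)` of `q`
(`annLie`) is bracket-closed with `Θ ∈ 𝔞_ℂ` by descent (`mem_spanC_annLie`), i.e. admissible, so `Y ∈ 𝔞_ℂ` (§4) and `𝔞_ℂ`
kills `q_ℂ`. The Lie step of Ribet's «`Hg(A) = Lf(A)` and thus `Hdg(Aⁿ) = Div(Aⁿ)` for `n ≥ 1`» for such `A`, through the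
invariants of `∏_i Sp(T_i)` (Gordon p. 18); the two- and four-dimensional-block cases are the tree's
`wordDerAt_eq_zero_of_mapsTo_of_skew` and `SpBlocksTheta.wordDerAt_eq_zero_of_mapsTo_of_skew`.
[cite: Ribet1983, Thm. 1] [cite: Gordon1997, Thm. 6.3 (arXiv:alg-geom/9709030 p. 18)] [cite: MoonenZarhin1999LowDim, §3 (3.1) and Lemma (3.4)]
[cite: Deligne1982HodgeCycles, I §3 Prop. 3.4] [cite: Hazama1983, §3 (pp. 305–306)] -/
theorem SpBlocksThetaSix.wordDerAt_eq_zero_of_mapsTo_of_skew [Fintype ι] {M d m : ℕ} (H : HodgeStructure V n) (hn : n = 1)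
    (heff : H.IsEffective) (ψ : H.Polarization)
    (hself : ∀ a : H.endAlg, LinearMap.IsAdjointPair ψ.form ψ.form (a : Module.End ℚ V) (a : Module.End ℚ V))
    (σ : ι → (H.endAlg →+* ℂ)) (hreal : ∀ i, (starRingEnd ℂ).comp (σ i) = σ i)
    (hint : DirectSum.IsInternal fun i => H.eigenBlock (σ i)) (h6 : ∀ i, Module.finrank ℂ (H.eigenBlock (σ i)) = 6)
    (eQ : Module.Basis (Fin M) ℚ V) (q : (Fin d → Fin m × Fin M) → ℚ) {Θ : Module.End ℂ (ℂ ⊗[ℚ] V)}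
    (hΘ : ∀ p, ∀ x ∈ H.piece p (n - p), Θ x = ((2 * p - n : ℤ) : ℂ) • x)
    (hΘq : ∀ u : Fin d → Fin m, wordDerAt ℂ (fun _ : Fin d =>
      LinearMap.toMatrix (Algebra.TensorProduct.basis ℂ eQ) (Algebra.TensorProduct.basis ℂ eQ) Θ)
      (wordSlice (fun w => algebraMap ℚ ℂ (q w)) u) = 0)
    {Y : Module.End ℂ (ℂ ⊗[ℚ] V)} (hYT : ∀ i, Set.MapsTo Y (H.eigenBlock (σ i)) (H.eigenBlock (σ i)))
    (hYskew : ∀ x y, ψ.form.baseChange ℂ (Y x) y + ψ.form.baseChange ℂ x (Y y) = 0)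
    (u : Fin d → Fin m) :
    wordDerAt ℂ (fun _ : Fin d =>
      LinearMap.toMatrix (Algebra.TensorProduct.basis ℂ eQ) (Algebra.TensorProduct.basis ℂ eQ) Y)
      (wordSlice (fun w => algebraMap ℚ ℂ (q w)) u) = 0 := by
  -- the rational Lie algebra `𝔞 ⊆ 𝔰𝔭_E(V, ψ)` of `q`, with `E = End_Hdg(V)` itself as commuting family
  set 𝔞 : Submodule ℚ (Module.End ℚ V) := annLie ψ.form eQ (fun a : H.endAlg => (a : Module.End ℚ V)) q
    with h𝔞
  have hΘC : Θ ∈ H.hodgeLieC := H.mem_hodgeLieC_of_forall_piece hΘ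
  have hΘ𝔞 : Θ ∈ spanC 𝔞 :=
    mem_spanC_annLie ψ.form eQ _ q hΘq (fun a => commute_baseChange_of_mem_hodgeLieC H hΘC a)
      fun x y => by rw [formBaseChange_skew_of_mem_hodgeLieC ψ hΘC, neg_add_cancel]
  have hbr : ∀ X ∈ 𝔞, ∀ X' ∈ 𝔞, X * X' - X' * X ∈ 𝔞 := fun X hX X' hX' =>
    commutator_mem_annLie ψ.form eQ _ q hX hX'
  have hcomm : ∀ X ∈ 𝔞, ∀ a : H.endAlg, X * (a : Module.End ℚ V) = (a : Module.End ℚ V) * X :=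
    fun X hX a => ((mem_annLie_iff ψ.form eQ _ q X).1 hX).2.1 a
  have hskew : ∀ X ∈ 𝔞, ∀ v w, ψ.form (X v) w + ψ.form v (X w) = 0 :=
    fun X hX => ((mem_annLie_iff ψ.form eQ _ q X).1 hX).2.2
  have hY : Y ∈ spanC 𝔞 :=
    SpBlocksThetaSix.mem_spanC_of_mapsTo_of_skew H hn heff ψ hself σ hreal hint h6 𝔞 hbr hΘ hΘ𝔞 hcomm hskew hYT hYskew
  rw [h𝔞] at hY
  exact wordDerAt_eq_zero_of_mem_spanC_annLie ψ.form eQ _ q hY u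

end AnnLie

end HodgeStructure

end Literature.AlgebraicGeometry.Motives

end
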